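import Summits.ValiantsHypothesis.ValiantsHypothesis.Theses.NewtonUnitEquations
import Mathlib.Data.Finsupp.Lex
import Mathlib.Analysis.LocallyConvex.Separation
import Mathlib.Analysis.Convex.Extreme
import Mathlib.Analysis.Convex.Topology

/-!
# val-idea-35 g9 — the RANK-TWO COMPOSITION LAW via the JACOBIAN TRANSFER
(crux `stmt-ValiantsHypothesis-5906` `TwoProducts`, SIDE ladder of card «table-rank-ladder», K13 K1 = VERDICT #26 (U1)).

Nothing here closes 5906 / `PlanarCellBound`; **VP ≠ VNP is NOT proved**.  This file TYPES the theorem of memo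
`EXPT-rank2-jacobian-g9.md` and PROVES IT IN THE KERNEL (0 sorry, standard axioms): **`rankTwoCompositionLaw :
RankTwoCompositionLaw`** (K13 K1, g8's decl restated verbatim; exponent `c = 5`) via the crude explicit bound
`rankTwoCrudeBound : nv (P(w₁,w₂)) ≤ 2(m+1)(t⁴+3t²+3t+2) + 4` — section `TowerKernel` at the end (charts, Lemma 1, the
`d`-step tower induction, the vertex count by Hahn–Banach separation) on top of the five `PortPlan` hypotheses proved first:
Lemma 2 `axialTransfer : AxialTransfer` (the load-bearing step), Lemma 3 `chainRule : ChainRule` (composition ↦ product),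
Lemma 4 `ostrowski : Ostrowski`, Lemma 5 `jacSupportBound : JacSupportBound`, and `dependentCase : DependentCase`.
Still paper-only: the FINE constants (`JacobianTransferBound`, `RankTwoExplicitBound`: arcs instead of charts, `c = 2`).

THEOREM (paper, memo §2).  For `w₁ w₂ : ℂ[x,y]` with `≤ t` monomials and any `P`, `d := deg_{W₂} P`:
`nv (P(w₁,w₂)) ≤ nv (J(w₂,w₁)) + (2d+1)(4t−1) + 1 ≤ t² + (8d+4)t + 1`, where
`J(F,G) = θ₀F·θ₁G − θ₁F·θ₀G` (`θᵢ = Xᵢ∂ᵢ`) is the toric Jacobian (`≤ t²` monomials, support `⊆ S₁+S₂`).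
MECHANISM.  `J(P(w₁,w₂), w₁) = (∂_{W₂}P)(w₁,w₂) · J(w₂,w₁)` (chain rule: composition ↦ PRODUCT), products cannot hide
edges (Ostrowski), and `D ↦ J(D,w₁)` loses ≤ 2 edge directions per arc of directions (the «axial» ones through `ℝ·e`,
`e` = leading exponent of `w₁` on the arc); iterate `d` times down to `p_d(w₁)`, whose edge directions are exceptional.
-/

noncomputable section
set_option linter.dupNamespace false

namespace Summit.ValiantsHypothesis.ValiantsHypothesis.Cruxes.TwoProducts.ValIdea35g9

open scoped BigOperators
open MvPolynomial

abbrev Poly2 := MvPolynomial (Fin 2) ℂ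

/-- Planar embedding of an exponent (as in `TwoProducts` and the g8 ladder file). -/
def emb : (Fin 2 →₀ ℕ) → (Fin 2 → ℝ) := fun e i => ((e i : ℕ) : ℝ)

/-- Number of vertices of the Newton polygon of `D` (as in `TwoProducts` and the g8 ladder file). -/
def nv (D : Poly2) : ℕ :=
  (Set.extremePoints ℝ (convexHull ℝ (emb '' (D.support : Set (Fin 2 →₀ ℕ))))).ncard

/-- VERBATIM restatement of `Cruxes.TwoProducts.ValIdea35g8b.RankTwoCompositionLaw` (K13 K1, the open toy of record of
VERDICT #26): `Newt P(w₁,w₂)` has `poly(m,t)` vertices.  PROVED IN THE KERNEL below (`rankTwoCompositionLaw`, `c = 5`;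
the memo's arc count gives `c = 2` on paper).
(VERDICT #28 (J-i)): the two decls agree by `Iff.rfl` in any file importing both workfiles — `Cruxes/` modules are not in
the farm build (`lean check` of such a bridge answers `remote:stale:unbuilt`), so the bridge is recorded here and the
Theorems-lane port should state the law ONCE, against `Theses.NewtonUnitEquations` vocabulary.) -/
def RankTwoCompositionLaw : Prop :=
  ∃ c : ℕ, ∀ (m t : ℕ) (P : Poly2) (w₁ w₂ : Poly2),
    P.totalDegree ≤ m → w₁.support.card ≤ t → w₂.support.card ≤ t →
    nv (MvPolynomial.aeval ![w₁, w₂] P) ≤ (m + 2) ^ c * (t + 2) ^ c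

/-! ## The new object: the toric Jacobian -/

/-- Euler derivation `θᵢ = Xᵢ ∂ᵢ` (acts on monomials by `X^α ↦ αᵢ X^α`). -/
def theta (i : Fin 2) (F : Poly2) : Poly2 := X i * pderiv i F

/-- Toric Jacobian `J(F,G) = θ₀F·θ₁G − θ₁F·θ₀G`; on monomials `J(X^α, X^β) = det(α,β)·X^{α+β}`.  Bilinear,
antisymmetric, a derivation in each slot, kills constants; `J(F,G) = 0` iff `F, G` are algebraically dependent. -/
def jac (F G : Poly2) : Poly2 := theta 0 F * theta 1 G - theta 1 F * theta 0 G

/-! ## The bounds (paper theorems of the memo; statements) -/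

/-- EXPLICIT RANK-TWO BOUND (memo §2 Theorem, coarse form): `nv(P(w₁,w₂)) ≤ t² + (8m+4)t + 1` for `totalDegree P ≤ m`
(only `deg_{W₂} P ≤ m` is used).  Paper-proved; Lean port = `ChainRule` + `Ostrowski` + `AxialTransfer` + arc count. -/
def RankTwoExplicitBound : Prop :=
  ∀ (m t : ℕ) (P w₁ w₂ : Poly2),
    P.totalDegree ≤ m → w₁.support.card ≤ t → w₂.support.card ≤ t →
    nv (MvPolynomial.aeval ![w₁, w₂] P) ≤ t ^ 2 + (8 * m + 4) * t + 1

/-- JACOBIAN TRANSFER BOUND (memo §2 Theorem, fine form): all but `(2d+1)(4t−1)` vertices of `Newt P(w₁,w₂)` are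
accounted for by vertices of the single polynomial `J(w₂,w₁)`; `d = degreeOf 1 P = deg_{W₂} P`.  (With EPRS08,
`nv (jac w₂ w₁) = O(t^{4/3})`.)  The `ℕ`-subtraction `4 * t - 1` is harmless (VERDICT #28 (J-iii)): `t = 0` forces
`w₁ = w₂ = 0`, so `aeval ![0,0] P` is a constant and `nv ≤ 1`, within the bound `nv (jac 0 0) + 0 + 1 = 1`. -/
def JacobianTransferBound : Prop :=
  ∀ (t : ℕ) (P w₁ w₂ : Poly2),
    w₁.support.card ≤ t → w₂.support.card ≤ t →
    nv (MvPolynomial.aeval ![w₁, w₂] P) ≤ nv (jac w₂ w₁) + (2 * P.degreeOf 1 + 1) * (4 * t - 1) + 1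

/-! ## The five lemmas, typed (port plan; each routine — no Puiseux series, no analysis) -/

/-- `ν`-weight of an exponent. -/
def wt (ν : Fin 2 → ℝ) (e : Fin 2 →₀ ℕ) : ℝ := ν 0 * ((e 0 : ℕ) : ℝ) + ν 1 * ((e 1 : ℕ) : ℝ)

/-- `ν` is an (outer) EDGE DIRECTION of `Newt F`: two distinct support points maximise the `ν`-weight
(equivalently `in_ν F` is not a monomial).  `nv F ≤ #edge directions (mod positive scaling) + 1`. -/
def IsEdgeDir (ν : Fin 2 → ℝ) (F : Poly2) : Prop :=
  ∃ p ∈ F.support, ∃ q ∈ F.support, p ≠ q ∧ (∀ r ∈ F.support, wt ν r ≤ wt ν p) ∧ wt ν q = wt ν p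

/-- `det(p,e) = 0`: the exponent `p` lies on the line `ℝ·e` through the origin. -/
def OnAxis (p e : Fin 2 →₀ ℕ) : Prop := ((p 0 : ℕ) : ℤ) * ((e 1 : ℕ) : ℤ) = ((p 1 : ℕ) : ℤ) * ((e 0 : ℕ) : ℤ)

/-- AXIAL LEAD: `e ≠ 0` is the strict `ν`-top exponent of `w` among its NON-CONSTANT monomials and `⟨ν,e⟩ ≠ 0`.
(The constant term of `w` is irrelevant: `J(·,w)` kills it.)  For fixed `w` with `≤ t` monomials this holds, with a
locally constant `e`, for all `ν` off `≤ 3t` exceptional directions (edge normals of `conv(supp w ∖ 0)` and the lines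
`⟨ν,e⟩ = 0`) — memo Lemma 1. -/
def IsAxialLead (ν : Fin 2 → ℝ) (w : Poly2) (e : Fin 2 →₀ ℕ) : Prop :=
  e ∈ w.support ∧ e ≠ 0 ∧ wt ν e ≠ 0 ∧ ∀ s ∈ w.support, s ≠ 0 → s ≠ e → wt ν s < wt ν e

/-- `ν` is `e`-SPECIAL for `F`: the `ν`-top set of `supp F` is exactly two points, one of them on the axis `ℝ·e`.
On an arc where `e` is the axial lead, at most ONE vertex of the chain of `Newt F` facing the arc lies on `ℝ·e`
(two such differ by `λe`, and `⟨ν,λe⟩` has constant sign on the arc), hence ≤ 2 special directions per arc — memo Lemma 2. -/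
def IsSpecial (ν : Fin 2 → ℝ) (F : Poly2) (e : Fin 2 →₀ ℕ) : Prop :=
  ∃ p ∈ F.support, ∃ q ∈ F.support, p ≠ q ∧ (∀ r ∈ F.support, wt ν r ≤ wt ν p) ∧ wt ν q = wt ν p ∧
    (∀ r ∈ F.support, wt ν r = wt ν p → r = p ∨ r = q) ∧ (OnAxis p e ∨ OnAxis q e)

/-- LEMMA 2 (axial transfer; memo §1): if `e` is the axial lead of `w` at `ν` and `ν` is an edge direction of `F ≠ 0`,
then `ν` is `e`-special for `F` or an edge direction of `J(F,w)`.  Proof: the top `ν`-component of `J(F,w)` is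
`J(in_ν F, c X^e) = c Σ_γ F_γ det(γ,e) X^{γ+e}`, and the edge line `{⟨ν,·⟩ = M}` meets `ℝe` in ≤ 1 point. -/
def AxialTransfer : Prop :=
  ∀ (ν : Fin 2 → ℝ) (F w : Poly2) (e : Fin 2 →₀ ℕ),
    F ≠ 0 → IsAxialLead ν w e → IsEdgeDir ν F → IsSpecial ν F e ∨ IsEdgeDir ν (jac F w)

/-- LEMMA 3 (chain rule for the biderivation `J`; memo §1): COMPOSITION ↦ PRODUCT. -/
def ChainRule : Prop :=
  ∀ (P w₁ w₂ : Poly2),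
    jac (MvPolynomial.aeval ![w₁, w₂] P) w₁ = MvPolynomial.aeval ![w₁, w₂] (pderiv 1 P) * jac w₂ w₁

/-- LEMMA 4 (Ostrowski; memo §1): initial forms are multiplicative over a domain, so a product has an edge in direction
`ν` iff one of the factors does. -/
def Ostrowski : Prop :=
  ∀ (ν : Fin 2 → ℝ) (F G : Poly2), F ≠ 0 → G ≠ 0 → (IsEdgeDir ν (F * G) ↔ IsEdgeDir ν F ∨ IsEdgeDir ν G)

/-- LEMMA 5 (memo §1): `supp J(F,G) ⊆ supp F + supp G`, so `J(w₂,w₁)` has `≤ t²` monomials and `nv ≤ t²`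
(EPRS08: `O(t^{4/3})` vertices, as a convexly independent subset of `S₁+S₂`). -/
def JacSupportBound : Prop :=
  ∀ (F G : Poly2), (jac F G).support.card ≤ F.support.card * G.support.card ∧ nv (jac F G) ≤ (jac F G).support.card

/-- DEPENDENT CASE (memo §2 (i)): if `J(w₂,w₁) = 0` then `Newt P(w₁,w₂)` has no edge direction at any `ν` where `w₁`
has an axial lead (so `nv ≤ 3t + 1`). -/
def DependentCase : Prop :=
  ∀ (ν : Fin 2 → ℝ) (P w₁ w₂ : Poly2) (e : Fin 2 →₀ ℕ),
    jac w₂ w₁ = 0 → IsAxialLead ν w₁ e → ¬ IsEdgeDir ν (MvPolynomial.aeval ![w₁, w₂] P)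

/-- PORT PLAN (statement): the five lemmas give the fine bound; the fine bound gives the coarse one.  STATUS: all five
hypotheses of the first conjunct are kernel theorems of this file (`axialTransfer`, `chainRule`, `ostrowski`,
`jacSupportBound`, `dependentCase`), and the CRUDE form of the first implication (charts: `rankTwo_bound`, section
`TowerKernel`) is a kernel theorem too, giving `rankTwoCompositionLaw`; only the FINE constants of `JacobianTransferBound`
(`(2d+1)(4t−1)` via arcs) and hence `RankTwoExplicitBound` remain paper-only. -/
def PortPlan : Prop :=
  (AxialTransfer ∧ ChainRule ∧ Ostrowski ∧ JacSupportBound ∧ DependentCase → JacobianTransferBound) ∧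
  (JacobianTransferBound → RankTwoExplicitBound)

/-! ## Kernel-checked bookkeeping -/

/-- The arithmetic of Corollary (C1): `t² + (8m+4)t + 1 ≤ (m+2)²(t+2)²`. -/
theorem coarse_le_square (m t : ℕ) : t ^ 2 + (8 * m + 4) * t + 1 ≤ (m + 2) ^ 2 * (t + 2) ^ 2 := by
  have e : (m + 2) ^ 2 * (t + 2) ^ 2 =
      m ^ 2 * t ^ 2 + 4 * (m ^ 2 * t) + 4 * m ^ 2 + 4 * (m * t ^ 2) + 16 * (m * t) + 16 * m
        + 4 * t ^ 2 + 16 * t + 16 := by ring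
  have e2 : (8 * m + 4) * t = 8 * (m * t) + 4 * t := by ring
  rw [e, e2]
  have h1 := Nat.zero_le (m ^ 2 * t ^ 2)
  have h2 := Nat.zero_le (m ^ 2 * t)
  have h3 := Nat.zero_le (m * t ^ 2)
  omega

/-- K13 K1 from the explicit bound (Corollary C1 of the memo), kernel-checked: `c = 2`. -/
theorem rankTwoCompositionLaw_of_explicit (h : RankTwoExplicitBound) : RankTwoCompositionLaw :=
  ⟨2, fun m t P w₁ w₂ hP h₁ h₂ => (h m t P w₁ w₂ hP h₁ h₂).trans (coarse_le_square m t)⟩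

/-- Sanity of the new object on monomials is left to the port; here only: `J` kills constants in the second slot
(used in Lemma 1: the constant term of `w₁` never matters). -/
theorem jac_C_right (F : Poly2) (a : ℂ) : jac F (C a) = 0 := by
  simp [jac, theta]

/-- … and is alternating. -/
theorem jac_self (F : Poly2) : jac F F = 0 := by
  simp [jac, theta]; ring


/-! ## Kernel: Lemma 3 (chain rule) and Lemma 5 (support of the Jacobian), sorry-free -/

open scoped Pointwise

/-- `F ↦ J(F, G)` as a `ℂ`-derivation of `ℂ[x,y]`. -/
def jacDer (G : Poly2) : Derivation ℂ Poly2 Poly2 :=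
  (X 0 * theta 1 G) • (pderiv 0 : Derivation ℂ Poly2 Poly2) -
    (X 1 * theta 0 G) • (pderiv 1 : Derivation ℂ Poly2 Poly2)

theorem jacDer_apply (G F : Poly2) : jacDer G F = jac F G := by
  simp only [jacDer, Derivation.sub_apply, Derivation.smul_apply, smul_eq_mul, jac, theta]
  ring

/-- Chain rule for derivations along polynomial maps: `D(p(a)) = Σ_i (∂_i p)(a) · D(a_i)`. [folklore; the same
statement and proof as `Literature.ModelTheory.PseudofiniteFields.Derivation.map_mvPolynomial_aeval`, inlined to keep
this workfile's imports inside the Valiant cone] -/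
theorem derivation_map_aeval {R A M : Type*} [CommRing R] [CommRing A] [Algebra R A] [AddCommGroup M] [Module A M]
    [Module R M] {σ : Type*} [Fintype σ] [DecidableEq σ]
    (D : Derivation R A M) (a : σ → A) (p : MvPolynomial σ R) :
    D (aeval a p) = ∑ i, aeval a (pderiv i p) • D (a i) := by
  induction p using MvPolynomial.induction_on with
  | C r => simp
  | add p q hp hq =>
    simp only [map_add, hp, hq, add_smul, Finset.sum_add_distrib]
  | mul_X p s hp =>
    have hX : ∀ i : σ, aeval a (pderiv i (X s : MvPolynomial σ R)) = if s = i then (1 : A) else 0 := by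
      intro i
      rw [pderiv_X, Pi.single_apply]
      split_ifs <;> simp
    have hR : ∀ i, aeval a (pderiv i (p * X s)) • D (a i) =
        (a s * aeval a (pderiv i p)) • D (a i) + (if s = i then aeval a p • D (a i) else 0) := by
      intro i
      rw [Derivation.leibniz, map_add, smul_eq_mul, smul_eq_mul, map_mul, map_mul, aeval_X, hX,
        add_smul, add_comm]
      congr 1
      split_ifs <;> simp
    rw [map_mul, aeval_X, Derivation.leibniz, hp]
    simp_rw [hR, Finset.sum_add_distrib, Finset.sum_ite_eq, Finset.mem_univ, if_true]
    rw [add_comm, Finset.smul_sum]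
    congr 1
    refine Finset.sum_congr rfl fun i _ => ?_
    rw [smul_smul]

/-- **LEMMA 3 in the kernel** (`ChainRule`): `J(P(w₁,w₂), w₁) = (∂_{W₂}P)(w₁,w₂) · J(w₂,w₁)` — composition ↦ product. -/
theorem chainRule : ChainRule := by
  intro P w₁ w₂
  have h := derivation_map_aeval (jacDer w₁) ![w₁, w₂] P
  rw [jacDer_apply] at h
  rw [h, Fin.sum_univ_two]
  simp only [smul_eq_mul, jacDer_apply, Matrix.cons_val_zero, Matrix.cons_val_one, jac_self,
    mul_zero, zero_add]


theorem theta_monomial (i : Fin 2) (s : Fin 2 →₀ ℕ) (a : ℂ) :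
    theta i (monomial s a) = monomial s (a * (s i : ℂ)) := by
  unfold theta
  rw [pderiv_monomial]
  by_cases h : s i = 0
  · simp [h]
  · rw [show (X i : Poly2) = monomial (Finsupp.single i 1) 1 from rfl, monomial_mul, one_mul,
      add_tsub_cancel_of_le (Finsupp.single_le_iff.mpr (Nat.one_le_iff_ne_zero.mpr h))]

theorem theta_eq_sum (i : Fin 2) (F : Poly2) :
    theta i F = ∑ s ∈ F.support, monomial s (coeff s F * (s i : ℂ)) := by
  conv_lhs => rw [F.as_sum]
  unfold theta
  rw [map_sum, Finset.mul_sum]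
  refine Finset.sum_congr rfl fun s _ => ?_
  have := theta_monomial i s (coeff s F)
  unfold theta at this
  exact this

/-- `θᵢ` does not enlarge supports. -/
theorem support_theta_subset (i : Fin 2) (F : Poly2) : (theta i F).support ⊆ F.support := by
  rw [theta_eq_sum]
  intro e he
  obtain ⟨s, hs, hes⟩ := Finset.mem_biUnion.mp (MvPolynomial.support_sum he)
  have := MvPolynomial.support_monomial_subset hes
  rw [Finset.mem_singleton] at this
  rwa [this]

/-- LEMMA 5(a): `supp J(F,G) ⊆ supp F + supp G`. -/
theorem support_jac_subset (F G : Poly2) : (jac F G).support ⊆ F.support + G.support := by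
  unfold jac
  refine (MvPolynomial.support_sub ..).trans (Finset.union_subset ?_ ?_)
  · exact (MvPolynomial.support_mul _ _).trans
      (Finset.add_subset_add (support_theta_subset 0 F) (support_theta_subset 1 G))
  · exact (MvPolynomial.support_mul _ _).trans
      (Finset.add_subset_add (support_theta_subset 1 F) (support_theta_subset 0 G))

/-- LEMMA 5(b): `J(F,G)` has at most `|supp F|·|supp G|` monomials. -/
theorem card_support_jac_le (F G : Poly2) : (jac F G).support.card ≤ F.support.card * G.support.card :=
  (Finset.card_le_card (support_jac_subset F G)).trans Finset.card_add_le

/-- A Newton polygon has at most as many vertices as its polynomial has monomials. -/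
theorem nv_le_card_support (D : Poly2) : nv D ≤ D.support.card := by
  unfold nv
  have hfin : (emb '' (D.support : Set (Fin 2 →₀ ℕ))).Finite := (D.support.finite_toSet).image _
  calc (Set.extremePoints ℝ (convexHull ℝ (emb '' (D.support : Set (Fin 2 →₀ ℕ))))).ncard
      ≤ (emb '' (D.support : Set (Fin 2 →₀ ℕ))).ncard :=
        Set.ncard_le_ncard (extremePoints_convexHull_subset) hfin
    _ ≤ (D.support : Set (Fin 2 →₀ ℕ)).ncard := Set.ncard_image_le D.support.finite_toSet
    _ = D.support.card := Set.ncard_coe_finset _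

/-- **LEMMA 5 in the kernel** (`JacSupportBound`). -/
theorem jacSupportBound : JacSupportBound := fun F G =>
  ⟨card_support_jac_le F G, nv_le_card_support _⟩


/-! ## Kernel: Lemma 4 (Ostrowski: edge directions of a product), sorry-free
The top `ν`-weight points of `supp (F·G)` are controlled through the lexicographic extremes (`Finsupp.Lex`) of the
top sets of `F` and `G`: `lexmax + lexmax` and `lexmin + lexmin` have unique support decompositions, so their
coefficients are products of nonzero coefficients (no initial-form algebra needed). -/

theorem wt_add (ν : Fin 2 → ℝ) (a b : Fin 2 →₀ ℕ) : wt ν (a + b) = wt ν a + wt ν b := by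
  simp only [wt, Finsupp.add_apply, Nat.cast_add]; ring

theorem support_nonempty' {F : Poly2} (hF : F ≠ 0) : F.support.Nonempty :=
  Finset.nonempty_of_ne_empty (by rwa [Ne, MvPolynomial.support_eq_empty])

theorem coeff_eq_zero_of_not_mem {F : Poly2} {a : Fin 2 →₀ ℕ} (ha : a ∉ F.support) : coeff a F = 0 := by
  simpa [MvPolynomial.mem_support_iff] using ha

/-- Coefficient of a product at a sum with a unique support decomposition. -/
theorem coeff_mul_of_unique (F G : Poly2) (a₀ b₀ : Fin 2 →₀ ℕ)
    (h : ∀ a ∈ F.support, ∀ b ∈ G.support, a + b = a₀ + b₀ → a = a₀ ∧ b = b₀) :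
    coeff (a₀ + b₀) (F * G) = coeff a₀ F * coeff b₀ G := by
  rw [coeff_mul]
  apply Finset.sum_eq_single (a₀, b₀)
  · rintro ⟨a, b⟩ hab hne
    rw [Finset.HasAntidiagonal.mem_antidiagonal] at hab
    by_cases ha : a ∈ F.support
    · by_cases hb : b ∈ G.support
      · obtain ⟨rfl, rfl⟩ := h a ha b hb hab
        exact absurd rfl hne
      · simp only [coeff_eq_zero_of_not_mem hb, mul_zero]
    · simp only [coeff_eq_zero_of_not_mem ha, zero_mul]
  · intro hn
    exfalso; apply hn
    rw [Finset.HasAntidiagonal.mem_antidiagonal]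

/-- The lex-MAX version of the unique-decomposition argument. -/
theorem decomp_max (ν : Fin 2 → ℝ) (F G : Poly2) (p q a₀ b₀ : Fin 2 →₀ ℕ)
    (hpmax : ∀ r ∈ F.support, wt ν r ≤ wt ν p) (hqmax : ∀ r ∈ G.support, wt ν r ≤ wt ν q)
    (ha₀ : wt ν a₀ = wt ν p) (hb₀ : wt ν b₀ = wt ν q)
    (hla : ∀ e ∈ F.support, wt ν e = wt ν p → toLex e ≤ toLex a₀)
    (hlb : ∀ e ∈ G.support, wt ν e = wt ν q → toLex e ≤ toLex b₀) :
    ∀ a ∈ F.support, ∀ b ∈ G.support, a + b = a₀ + b₀ → a = a₀ ∧ b = b₀ := by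
  intro a ha b hb hab
  have hw : wt ν a + wt ν b = wt ν p + wt ν q := by
    rw [← wt_add, hab, wt_add, ha₀, hb₀]
  have hwa : wt ν a = wt ν p := by linarith [hpmax a ha, hqmax b hb]
  have hwb : wt ν b = wt ν q := by linarith [hpmax a ha, hqmax b hb]
  have h1 := hla a ha hwa
  have h2 := hlb b hb hwb
  have hsum : toLex a + toLex b = toLex a₀ + toLex b₀ := by
    show toLex (a + b) = toLex (a₀ + b₀); rw [hab]
  have haeq : a = a₀ := by
    rcases h1.lt_or_eq with hlt | heq
    · exact absurd hsum (ne_of_lt (add_lt_add_of_lt_of_le hlt h2))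
    · exact toLex_inj.mp heq
  refine ⟨haeq, ?_⟩
  rw [haeq] at hab
  exact add_left_cancel hab

/-- The lex-MIN version. -/
theorem decomp_min (ν : Fin 2 → ℝ) (F G : Poly2) (p q a₀ b₀ : Fin 2 →₀ ℕ)
    (hpmax : ∀ r ∈ F.support, wt ν r ≤ wt ν p) (hqmax : ∀ r ∈ G.support, wt ν r ≤ wt ν q)
    (ha₀ : wt ν a₀ = wt ν p) (hb₀ : wt ν b₀ = wt ν q)
    (hla : ∀ e ∈ F.support, wt ν e = wt ν p → toLex a₀ ≤ toLex e)
    (hlb : ∀ e ∈ G.support, wt ν e = wt ν q → toLex b₀ ≤ toLex e) :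
    ∀ a ∈ F.support, ∀ b ∈ G.support, a + b = a₀ + b₀ → a = a₀ ∧ b = b₀ := by
  intro a ha b hb hab
  have hw : wt ν a + wt ν b = wt ν p + wt ν q := by
    rw [← wt_add, hab, wt_add, ha₀, hb₀]
  have hwa : wt ν a = wt ν p := by linarith [hpmax a ha, hqmax b hb]
  have hwb : wt ν b = wt ν q := by linarith [hpmax a ha, hqmax b hb]
  have h1 := hla a ha hwa
  have h2 := hlb b hb hwb
  have hsum : toLex a₀ + toLex b₀ = toLex a + toLex b := by
    show toLex (a₀ + b₀) = toLex (a + b); rw [hab]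
  have haeq : a = a₀ := by
    rcases h1.lt_or_eq with hlt | heq
    · exact absurd hsum (ne_of_lt (add_lt_add_of_lt_of_le hlt h2))
    · exact (toLex_inj.mp heq).symm
  refine ⟨haeq, ?_⟩
  rw [haeq] at hab
  exact add_left_cancel hab

/-- An edge of `F` survives multiplication by any `G ≠ 0` (half of Ostrowski). -/
theorem isEdgeDir_mul_left (ν : Fin 2 → ℝ) (F G : Poly2) (hG : G ≠ 0) (hFe : IsEdgeDir ν F) :
    IsEdgeDir ν (F * G) := by
  obtain ⟨p, hp, p', hp', hpp', hpmax, hwp'⟩ := hFe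
  obtain ⟨q, hq, hqmax⟩ := Finset.exists_max_image G.support (wt ν) (support_nonempty' hG)
  set TF := F.support.filter (fun e => wt ν e = wt ν p) with hTF
  set TG := G.support.filter (fun e => wt ν e = wt ν q) with hTG
  have hpTF : p ∈ TF := Finset.mem_filter.mpr ⟨hp, rfl⟩
  have hp'TF : p' ∈ TF := Finset.mem_filter.mpr ⟨hp', hwp'⟩
  have hqTG : q ∈ TG := Finset.mem_filter.mpr ⟨hq, rfl⟩
  obtain ⟨aM, haM, haMmax⟩ := Finset.exists_max_image TF (fun e => toLex e) ⟨p, hpTF⟩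
  obtain ⟨am, ham, hammin⟩ := Finset.exists_min_image TF (fun e => toLex e) ⟨p, hpTF⟩
  obtain ⟨bM, hbM, hbMmax⟩ := Finset.exists_max_image TG (fun e => toLex e) ⟨q, hqTG⟩
  obtain ⟨bm, hbm, hbmmin⟩ := Finset.exists_min_image TG (fun e => toLex e) ⟨q, hqTG⟩
  have haM' := Finset.mem_filter.mp haM
  have ham' := Finset.mem_filter.mp ham
  have hbM' := Finset.mem_filter.mp hbM
  have hbm' := Finset.mem_filter.mp hbm
  -- aM ≠ am because TF has the two elements p ≠ p'
  have hlt_a : toLex am < toLex aM := by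
    rcases (hammin p hpTF).lt_or_eq with h1 | h1
    · exact lt_of_lt_of_le h1 (haMmax p hpTF)
    · rcases (hammin p' hp'TF).lt_or_eq with h2 | h2
      · exact lt_of_lt_of_le h2 (haMmax p' hp'TF)
      · exact absurd (toLex_inj.mp (h1.symm.trans h2)) hpp'
  have hle_b : toLex bm ≤ toLex bM := (hbmmin q hqTG).trans (hbMmax q hqTG)
  -- unique decompositions
  have hdecM := decomp_max ν F G p q aM bM hpmax hqmax haM'.2 hbM'.2
    (fun e he hwe => haMmax e (Finset.mem_filter.mpr ⟨he, hwe⟩))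
    (fun e he hwe => hbMmax e (Finset.mem_filter.mpr ⟨he, hwe⟩))
  have hdecm := decomp_min ν F G p q am bm hpmax hqmax ham'.2 hbm'.2
    (fun e he hwe => hammin e (Finset.mem_filter.mpr ⟨he, hwe⟩))
    (fun e he hwe => hbmmin e (Finset.mem_filter.mpr ⟨he, hwe⟩))
  have hsM : aM + bM ∈ (F * G).support := by
    rw [MvPolynomial.mem_support_iff, coeff_mul_of_unique F G aM bM hdecM]
    exact mul_ne_zero (MvPolynomial.mem_support_iff.mp haM'.1) (MvPolynomial.mem_support_iff.mp hbM'.1)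
  have hsm : am + bm ∈ (F * G).support := by
    rw [MvPolynomial.mem_support_iff, coeff_mul_of_unique F G am bm hdecm]
    exact mul_ne_zero (MvPolynomial.mem_support_iff.mp ham'.1) (MvPolynomial.mem_support_iff.mp hbm'.1)
  have hne : aM + bM ≠ am + bm := by
    intro h
    have h' : toLex aM + toLex bM = toLex am + toLex bm := by
      show toLex (aM + bM) = toLex (am + bm); rw [h]
    exact absurd h'.symm (ne_of_lt (add_lt_add_of_lt_of_le hlt_a hle_b))
  refine ⟨aM + bM, hsM, am + bm, hsm, hne, ?_, ?_⟩
  · intro r hr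
    obtain ⟨a, ha, b, hb, rfl⟩ := Finset.mem_add.mp (MvPolynomial.support_mul F G hr)
    rw [wt_add, wt_add, haM'.2, hbM'.2]
    linarith [hpmax a ha, hqmax b hb]
  · rw [wt_add, wt_add, haM'.2, hbM'.2, ham'.2, hbm'.2]

/-- **LEMMA 4 in the kernel** (Ostrowski): over the domain `ℂ`, `ν` is an edge direction of `F·G` iff it is one
of `F` or of `G`. -/
theorem ostrowski : Ostrowski := by
  intro ν F G hF hG
  constructor
  · intro hFG
    by_contra hnot
    push Not at hnot
    obtain ⟨hnF, hnG⟩ := hnot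
    obtain ⟨p, hp, hpmax⟩ := Finset.exists_max_image F.support (wt ν) (support_nonempty' hF)
    obtain ⟨q, hq, hqmax⟩ := Finset.exists_max_image G.support (wt ν) (support_nonempty' hG)
    have huF : ∀ a ∈ F.support, wt ν a = wt ν p → a = p := by
      intro a ha hwa
      by_contra hne
      exact hnF ⟨p, hp, a, ha, fun h => hne h.symm, hpmax, hwa⟩
    have huG : ∀ b ∈ G.support, wt ν b = wt ν q → b = q := by
      intro b hb hwb
      by_contra hne
      exact hnG ⟨q, hq, b, hb, fun h => hne h.symm, hqmax, hwb⟩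
    have hdec : ∀ a ∈ F.support, ∀ b ∈ G.support, wt ν (a + b) = wt ν (p + q) → a = p ∧ b = q := by
      intro a ha b hb hw
      rw [wt_add, wt_add] at hw
      have hwa : wt ν a = wt ν p := by linarith [hpmax a ha, hqmax b hb]
      have hwb : wt ν b = wt ν q := by linarith [hpmax a ha, hqmax b hb]
      exact ⟨huF a ha hwa, huG b hb hwb⟩
    have hpq : p + q ∈ (F * G).support := by
      rw [MvPolynomial.mem_support_iff, coeff_mul_of_unique F G p q
        (fun a ha b hb he => hdec a ha b hb (by rw [he]))]
      exact mul_ne_zero (MvPolynomial.mem_support_iff.mp hp) (MvPolynomial.mem_support_iff.mp hq)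
    obtain ⟨r, hr, r', hr', hne, hrmax, hwr'⟩ := hFG
    have key : ∀ s ∈ (F * G).support, wt ν s = wt ν r → s = p + q := by
      intro s hs hws
      obtain ⟨a, ha, b, hb, rfl⟩ := Finset.mem_add.mp (MvPolynomial.support_mul F G hs)
      have hle : wt ν (p + q) ≤ wt ν r := hrmax _ hpq
      have hge : wt ν (a + b) ≤ wt ν (p + q) := by
        rw [wt_add, wt_add]; linarith [hpmax a ha, hqmax b hb]
      have hab := hdec a ha b hb (by linarith)
      rw [hab.1, hab.2]
    exact hne ((key r hr rfl).trans (key r' hr' hwr').symm)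
  · rintro (hFe | hGe)
    · exact isEdgeDir_mul_left ν F G hG hFe
    · rw [mul_comm]; exact isEdgeDir_mul_left ν G F hF hGe


/-! ## Kernel: Lemma 2 (AXIAL TRANSFER — the load-bearing step), sorry-free
`J(F,w)` is an explicit double sum of monomials `F_γ w_s det(γ,s) X^{γ+s}`; above a top point `γ₀` of `F` the
coefficient of `X^{γ₀+e}` is `F_{γ₀} w_e det(γ₀,e)` (unique decomposition, the constant term of `w` being killed by
`det(γ,0) = 0`), and two top points on the axis `ℝ·e` coincide because `⟨ν,e⟩ ≠ 0`. -/

/-- integer determinant of two exponents -/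
def idet (γ s : Fin 2 →₀ ℕ) : ℤ := ((γ 0 : ℕ) : ℤ) * ((s 1 : ℕ) : ℤ) - ((γ 1 : ℕ) : ℤ) * ((s 0 : ℕ) : ℤ)

theorem onAxis_iff_idet (p e : Fin 2 →₀ ℕ) : OnAxis p e ↔ idet p e = 0 := by
  unfold OnAxis idet; constructor <;> intro h <;> linarith

theorem idet_zero_right (γ : Fin 2 →₀ ℕ) : idet γ 0 = 0 := by simp [idet]

/-- `J(F,w)` as an explicit double sum of monomials. -/
theorem jac_eq_sum (F w : Poly2) :
    jac F w = ∑ γ ∈ F.support, ∑ s ∈ w.support,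
      monomial (γ + s) (coeff γ F * coeff s w * ((idet γ s : ℤ) : ℂ)) := by
  unfold jac
  rw [theta_eq_sum 0 F, theta_eq_sum 1 w, theta_eq_sum 1 F, theta_eq_sum 0 w,
    Finset.sum_mul_sum, Finset.sum_mul_sum, ← Finset.sum_sub_distrib]
  refine Finset.sum_congr rfl fun γ _ => ?_
  rw [← Finset.sum_sub_distrib]
  refine Finset.sum_congr rfl fun s _ => ?_
  rw [monomial_mul, monomial_mul, ← map_sub]
  congr 1
  simp only [idet, Int.cast_sub, Int.cast_mul, Int.cast_natCast]
  ring

theorem coeff_jac (F w : Poly2) (u : Fin 2 →₀ ℕ) :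
    coeff u (jac F w) = ∑ x ∈ F.support ×ˢ w.support,
      (if x.1 + x.2 = u then coeff x.1 F * coeff x.2 w * ((idet x.1 x.2 : ℤ) : ℂ) else 0) := by
  rw [jac_eq_sum, coeff_sum, Finset.sum_product]
  refine Finset.sum_congr rfl fun γ _ => ?_
  rw [coeff_sum]
  refine Finset.sum_congr rfl fun s _ => ?_
  rw [coeff_monomial]

/-- Every support point of `J(F,w)` is `γ + s` with `γ ∈ supp F`, `s ∈ supp w` and `det(γ,s) ≠ 0`. -/
theorem exists_of_mem_support_jac (F w : Poly2) (u : Fin 2 →₀ ℕ) (hu : u ∈ (jac F w).support) :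
    ∃ γ ∈ F.support, ∃ s ∈ w.support, γ + s = u ∧ idet γ s ≠ 0 := by
  rw [MvPolynomial.mem_support_iff, coeff_jac] at hu
  obtain ⟨⟨γ, s⟩, hx, hne⟩ := Finset.exists_ne_zero_of_sum_ne_zero hu
  obtain ⟨hγ, hs⟩ := Finset.mem_product.mp hx
  refine ⟨γ, hγ, s, hs, ?_, ?_⟩
  · by_contra h
    exact hne (if_neg h)
  · intro h
    apply hne
    simp [h]

/-- The TOP coefficient of `J(F,w)` above a top point `γ₀` of `F`, when `e` is the axial lead of `w`. -/
theorem coeff_jac_top (ν : Fin 2 → ℝ) (F w : Poly2) (e γ₀ : Fin 2 →₀ ℕ) (hlead : IsAxialLead ν w e)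
    (hγ₀ : γ₀ ∈ F.support) (htop : ∀ r ∈ F.support, wt ν r ≤ wt ν γ₀) :
    coeff (γ₀ + e) (jac F w) = coeff γ₀ F * coeff e w * ((idet γ₀ e : ℤ) : ℂ) := by
  obtain ⟨he, he0, hwe, hdom⟩ := hlead
  rw [coeff_jac]
  rw [Finset.sum_eq_single (γ₀, e)]
  · simp
  · rintro ⟨γ, s⟩ hx hne
    obtain ⟨hγ, hs⟩ := Finset.mem_product.mp hx
    dsimp only
    split_ifs with h
    · -- γ + s = γ₀ + e with (γ,s) ≠ (γ₀,e): only possible with s = 0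
      by_cases hs0 : s = 0
      · subst hs0; simp [idet_zero_right]
      · exfalso
        by_cases hse : s = e
        · subst hse
          exact hne (Prod.ext (add_right_cancel h) rfl)
        · have hlt := hdom s hs hs0 hse
          have hle := htop γ hγ
          have hw : wt ν γ + wt ν s = wt ν γ₀ + wt ν e := by rw [← wt_add, ← wt_add, h]
          linarith
    · rfl
  · intro hn
    exact absurd (Finset.mem_product.mpr ⟨hγ₀, he⟩) hn

/-- Two top points of `F` on the axis `ℝ·e` coincide (the axis meets the top line once, as `⟨ν,e⟩ ≠ 0`). -/
theorem onAxis_unique (ν : Fin 2 → ℝ) (e γ₁ γ₂ : Fin 2 →₀ ℕ) (hwe : wt ν e ≠ 0)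
    (hw : wt ν γ₁ = wt ν γ₂) (h1 : OnAxis γ₁ e) (h2 : OnAxis γ₂ e) : γ₁ = γ₂ := by
  unfold OnAxis at h1 h2
  have h1r : ((γ₁ 0 : ℕ) : ℝ) * ((e 1 : ℕ) : ℝ) = ((γ₁ 1 : ℕ) : ℝ) * ((e 0 : ℕ) : ℝ) := by exact_mod_cast h1
  have h2r : ((γ₂ 0 : ℕ) : ℝ) * ((e 1 : ℕ) : ℝ) = ((γ₂ 1 : ℕ) : ℝ) * ((e 0 : ℕ) : ℝ) := by exact_mod_cast h2
  unfold wt at hw hwe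
  -- γ_i · W = e_i · wt γ
  have k10 : ((γ₁ 0 : ℕ) : ℝ) * (ν 0 * ((e 0 : ℕ) : ℝ) + ν 1 * ((e 1 : ℕ) : ℝ)) =
      ((e 0 : ℕ) : ℝ) * (ν 0 * ((γ₁ 0 : ℕ) : ℝ) + ν 1 * ((γ₁ 1 : ℕ) : ℝ)) := by linear_combination (ν 1) * h1r
  have k20 : ((γ₂ 0 : ℕ) : ℝ) * (ν 0 * ((e 0 : ℕ) : ℝ) + ν 1 * ((e 1 : ℕ) : ℝ)) =
      ((e 0 : ℕ) : ℝ) * (ν 0 * ((γ₂ 0 : ℕ) : ℝ) + ν 1 * ((γ₂ 1 : ℕ) : ℝ)) := by linear_combination (ν 1) * h2r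
  have k11 : ((γ₁ 1 : ℕ) : ℝ) * (ν 0 * ((e 0 : ℕ) : ℝ) + ν 1 * ((e 1 : ℕ) : ℝ)) =
      ((e 1 : ℕ) : ℝ) * (ν 0 * ((γ₁ 0 : ℕ) : ℝ) + ν 1 * ((γ₁ 1 : ℕ) : ℝ)) := by linear_combination (-(ν 0)) * h1r
  have k21 : ((γ₂ 1 : ℕ) : ℝ) * (ν 0 * ((e 0 : ℕ) : ℝ) + ν 1 * ((e 1 : ℕ) : ℝ)) =
      ((e 1 : ℕ) : ℝ) * (ν 0 * ((γ₂ 0 : ℕ) : ℝ) + ν 1 * ((γ₂ 1 : ℕ) : ℝ)) := by linear_combination (-(ν 0)) * h2r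
  have e0 : ((γ₁ 0 : ℕ) : ℝ) = ((γ₂ 0 : ℕ) : ℝ) := by
    apply mul_right_cancel₀ hwe
    rw [k10, k20, hw]
  have e1 : ((γ₁ 1 : ℕ) : ℝ) = ((γ₂ 1 : ℕ) : ℝ) := by
    apply mul_right_cancel₀ hwe
    rw [k11, k21, hw]
  ext i
  fin_cases i
  · exact_mod_cast e0
  · exact_mod_cast e1

/-- **LEMMA 2 in the kernel** (axial transfer). -/
theorem axialTransfer : AxialTransfer := by
  intro ν F w e hF hlead hedge
  have hlead' := hlead
  obtain ⟨he, he0, hwe, hdom⟩ := hlead'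
  obtain ⟨p, hp, q, hq, hpq, hpmax, hwq⟩ := hedge
  by_cases hax : ∃ γ₁ ∈ F.support, ∃ γ₂ ∈ F.support,
      γ₁ ≠ γ₂ ∧ wt ν γ₁ = wt ν p ∧ wt ν γ₂ = wt ν p ∧ ¬ OnAxis γ₁ e ∧ ¬ OnAxis γ₂ e
  · -- Case A: two top points off the axis ⇒ an edge of J(F,w) in direction ν
    right
    obtain ⟨γ₁, h1, γ₂, h2, hne, hw1, hw2, hna1, hna2⟩ := hax
    have top1 : ∀ r ∈ F.support, wt ν r ≤ wt ν γ₁ := fun r hr => hw1 ▸ hpmax r hr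
    have top2 : ∀ r ∈ F.support, wt ν r ≤ wt ν γ₂ := fun r hr => hw2 ▸ hpmax r hr
    have mem : ∀ γ ∈ F.support, (∀ r ∈ F.support, wt ν r ≤ wt ν γ) → ¬ OnAxis γ e →
        γ + e ∈ (jac F w).support := by
      intro γ hγ htop hna
      rw [MvPolynomial.mem_support_iff, coeff_jac_top ν F w e γ hlead hγ htop]
      refine mul_ne_zero (mul_ne_zero (MvPolynomial.mem_support_iff.mp hγ) (MvPolynomial.mem_support_iff.mp he)) ?_
      rw [Int.cast_ne_zero, Ne, ← onAxis_iff_idet]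
      exact hna
    refine ⟨γ₁ + e, mem γ₁ h1 top1 hna1, γ₂ + e, mem γ₂ h2 top2 hna2, ?_, ?_, ?_⟩
    · intro h; exact hne (add_right_cancel h)
    · intro r hr
      obtain ⟨γ, hγ, s, hs, rfl, hdet⟩ := exists_of_mem_support_jac F w r hr
      have hs0 : s ≠ 0 := by rintro rfl; exact hdet (idet_zero_right γ)
      have hws : wt ν s ≤ wt ν e := by
        by_cases hse : s = e
        · rw [hse]
        · exact le_of_lt (hdom s hs hs0 hse)
      rw [wt_add, wt_add]
      linarith [top1 γ hγ]
    · rw [wt_add, wt_add, hw1, hw2]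
  · -- Case B: at most one top point off the axis ⇒ ν is e-special for F
    left
    push Not at hax
    have uniq : ∀ γ₁ γ₂ : Fin 2 →₀ ℕ, wt ν γ₁ = wt ν p → wt ν γ₂ = wt ν p → OnAxis γ₁ e → OnAxis γ₂ e → γ₁ = γ₂ :=
      fun γ₁ γ₂ hw1 hw2 h1 h2 => onAxis_unique ν e γ₁ γ₂ hwe (hw1.trans hw2.symm) h1 h2
    refine ⟨p, hp, q, hq, hpq, hpmax, hwq, ?_, ?_⟩
    · intro r hr hwr
      by_contra hnot
      push Not at hnot
      obtain ⟨hrp, hrq⟩ := hnot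
      by_cases hpa : OnAxis p e
      · have hqa : ¬ OnAxis q e := fun h => hpq (uniq p q rfl hwq hpa h)
        have hra : ¬ OnAxis r e := fun h => hrp (uniq r p hwr rfl h hpa)
        exact hra (hax q hq r hr (fun h => hrq h.symm) hwq hwr hqa)
      · have hqa : OnAxis q e := hax p hp q hq hpq rfl hwq hpa
        have hra : OnAxis r e := hax p hp r hr (fun h => hrp h.symm) rfl hwr hpa
        exact hrq (uniq r q hwr hwq hra hqa)
    · by_contra hno
      push Not at hno
      exact hno.2 (hax p hp q hq hpq rfl hwq hno.1)


/-! ## Kernel: the dependent case `J(w₂,w₁) = 0` (memo §2 (i)), sorry-free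
By the chain rule `J(D,w₁) = 0`; by the top-coefficient formula every top point of `D` at `ν` lies on the axis `ℝ·e`,
and two such points coincide — so `D` has no edge in any direction where `w₁` has an axial lead. -/

theorem dependentCase : DependentCase := by
  intro ν P w₁ w₂ e hJ hlead hedge
  have hcr : ∀ (P w₁ w₂ : Poly2),
      jac (MvPolynomial.aeval ![w₁, w₂] P) w₁ = MvPolynomial.aeval ![w₁, w₂] (pderiv 1 P) * jac w₂ w₁ := chainRule
  have hJD : jac (MvPolynomial.aeval ![w₁, w₂] P) w₁ = 0 := by rw [hcr P w₁ w₂, hJ, mul_zero]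
  obtain ⟨p, hp, q, hq, hpq, hpmax, hwq⟩ := hedge
  have hwe : wt ν e ≠ 0 := hlead.2.2.1
  have onax : ∀ γ ∈ (MvPolynomial.aeval ![w₁, w₂] P).support, wt ν γ = wt ν p → OnAxis γ e := by
    intro γ hγ hw
    have htop : ∀ r ∈ (MvPolynomial.aeval ![w₁, w₂] P).support, wt ν r ≤ wt ν γ :=
      fun r hr => hw ▸ hpmax r hr
    have hc := coeff_jac_top ν _ w₁ e γ hlead hγ htop
    rw [hJD, coeff_zero] at hc
    have hdet : ((idet γ e : ℤ) : ℂ) = 0 := by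
      rcases mul_eq_zero.mp hc.symm with h | h
      · rcases mul_eq_zero.mp h with h | h
        · exact absurd h (MvPolynomial.mem_support_iff.mp hγ)
        · exact absurd h (MvPolynomial.mem_support_iff.mp hlead.1)
      · exact h
    rw [onAxis_iff_idet]
    exact_mod_cast hdet
  exact hpq (onAxis_unique ν e p q hwe hwq.symm (onax p hp rfl) (onax q hq hwq))


/-! ## KERNEL PORT of `PortPlan.1` ⇒ K1: the TOWER THEOREM, sorry-free (g9, 2026-08-29 ≈03:50Z)

The remaining implication (Lemma 1 bookkeeping + `d`-step tower induction + vertex count) is proved below in CHARTS instead of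
arcs: every non-horizontal direction is a positive multiple of `dir σ λ = (λ, σ)`, `σ = ±1`; in a chart the exceptional values of
`λ` for `w₁` form the finite set `Xc σ w₁` (pairwise crossings of support lines and axis values, `≤ t²+t`), the edge values of `F`
form `Eset σ F` (`≤ |supp F|²`), and
* `axialLead_of_not_mem`: off `Xc`, `w₁` has an axial lead `e` (Lemma 1);
* `card_Spec_le`: the `e`-special edge values of ANY `F` number `≤ 2(|Xc|+1)` (per gap of `Xc` the lead is constant, and two
  special values in one gap share their axis top point and are the two edge values adjacent to it — Lemma 2's count, crude form);
* `Eset_step` / `tower`: `Eset(F_Q) ⊆ Xc ∪ Spec(F_Q) ∪ Eset(F_{∂₂Q}) ∪ Eset(J)` (axial transfer + chain rule + Ostrowski), whence by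
  induction on the `W₂`-degree `|Eset σ (P(w₁,w₂))| ≤ (m+1)(3|Xc|+2+|Eset σ J(w₂,w₁)|)`;
* `extreme_subset` / `nv_le`: every vertex of `Newt F` is a chart-unique top for `σ = 1` or `σ = -1` or one of the two horizontal
  extremes (Hahn–Banach separation from the hull of the other support points), and unique tops number `≤ |Eset| + 1` per chart
  (`card_utop_le`: consecutive tops are separated by a tie value);
* `rankTwo_bound` (abstract in `jac` through the four kernel properties) ⇒ `rankTwoCrudeBound` ⇒ `rankTwoCompositionLaw` (`c = 5`).
-/

section TowerKernel
open scoped Classical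


abbrev Expo := Fin 2 →₀ ℕ

/-- chart direction `(l, σ)`, `σ = ±1` -/
def dir (σ l : ℝ) : Fin 2 → ℝ := ![l, σ]

theorem wt_dir (σ l : ℝ) (q : Expo) :
    wt (dir σ l) q = l * ((q 0 : ℕ) : ℝ) + σ * ((q 1 : ℕ) : ℝ) := by
  simp [wt, dir]

/-- a tie (≥ 2 top points) of the finite exponent set `S` in direction `ν`;
`IsEdgeDir ν F` is literally `TieIn ν F.support`. -/
def TieIn (ν : Fin 2 → ℝ) (S : Finset Expo) : Prop :=
  ∃ p ∈ S, ∃ q ∈ S, p ≠ q ∧ (∀ r ∈ S, wt ν r ≤ wt ν p) ∧ wt ν q = wt ν p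

/-- `p` is the unique top point of `S` in direction `ν` -/
def IsUTop (ν : Fin 2 → ℝ) (S : Finset Expo) (p : Expo) : Prop :=
  p ∈ S ∧ ∀ r ∈ S, r ≠ p → wt ν r < wt ν p

theorem utop_unique {ν : Fin 2 → ℝ} {S : Finset Expo} {p p' : Expo} (hp : IsUTop ν S p)
    (hp' : IsUTop ν S p') : p = p' := by
  by_contra h
  have h1 := hp.2 p' hp'.1 (Ne.symm h)
  have h2 := hp'.2 p hp.1 h
  linarith

theorem not_tie_of_utop {ν : Fin 2 → ℝ} {S : Finset Expo} {p : Expo} (hp : IsUTop ν S p) :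
    ¬ TieIn ν S := by
  rintro ⟨a, ha, b, hb, hab, hamax, hba⟩
  -- a and b are both tops; p is the unique top, so a = p and b = p
  have ha' : a = p := by
    by_contra h; have := hp.2 a ha h; have := hamax p hp.1; linarith
  have hb' : b = p := by
    by_contra h; have := hp.2 b hb h; have := hamax p hp.1; linarith
  exact hab (ha'.trans hb'.symm)

theorem expo_eq_of_coords {a b : Expo} (h0 : a 0 = b 0) (h1 : a 1 = b 1) : a = b := by
  ext i; fin_cases i <;> assumption

theorem sigma_ne_zero {σ : ℝ} (hσ : σ = 1 ∨ σ = -1) : σ ≠ 0 := by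
  rcases hσ with h | h <;> simp [h]

/-- in a chart, equal weights and equal first coordinates force equality -/
theorem eq_of_wt_eq {σ : ℝ} (hσ : σ = 1 ∨ σ = -1) {l : ℝ} {a b : Expo} (h0 : a 0 = b 0)
    (hw : wt (dir σ l) a = wt (dir σ l) b) : a = b := by
  apply expo_eq_of_coords h0
  rw [wt_dir, wt_dir, h0] at hw
  have h2 : σ * ((a 1 : ℕ) : ℝ) = σ * ((b 1 : ℕ) : ℝ) := by linarith
  have := mul_left_cancel₀ (sigma_ne_zero hσ) h2
  exact_mod_cast this

/-- the crossing value of the pair `(a,b)` (with `a 0 ≠ b 0`) in chart `σ` -/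
def cross (σ : ℝ) (a b : Expo) : ℝ :=
  σ * (((b 1 : ℕ) : ℝ) - ((a 1 : ℕ) : ℝ)) / (((a 0 : ℕ) : ℝ) - ((b 0 : ℕ) : ℝ))

theorem wt_sub_eq (σ l : ℝ) (a b : Expo) :
    wt (dir σ l) a - wt (dir σ l) b =
      l * (((a 0 : ℕ) : ℝ) - ((b 0 : ℕ) : ℝ)) + σ * (((a 1 : ℕ) : ℝ) - ((b 1 : ℕ) : ℝ)) := by
  rw [wt_dir, wt_dir]; ring

theorem sub_ne_zero_of_ne0 {a b : Expo} (h0 : a 0 ≠ b 0) :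
    (((a 0 : ℕ) : ℝ) - ((b 0 : ℕ) : ℝ)) ≠ 0 := by
  intro h; apply h0; exact_mod_cast (sub_eq_zero.mp h)

theorem wt_eq_imp_cross {σ l : ℝ} {a b : Expo} (h0 : a 0 ≠ b 0)
    (hw : wt (dir σ l) a = wt (dir σ l) b) : l = cross σ a b := by
  have hd := sub_ne_zero_of_ne0 h0
  unfold cross
  rw [eq_div_iff hd]
  have := wt_sub_eq σ l a b
  rw [hw, sub_self] at this
  linarith

/-- `g(x) := wt_x a − wt_x b = (x − cross) · (a0 − b0)` -/
theorem wt_sub_eq_cross {σ : ℝ} (x : ℝ) {a b : Expo} (h0 : a 0 ≠ b 0) :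
    wt (dir σ x) a - wt (dir σ x) b = (x - cross σ a b) * (((a 0 : ℕ) : ℝ) - ((b 0 : ℕ) : ℝ)) := by
  have hd := sub_ne_zero_of_ne0 h0
  rw [wt_sub_eq]; unfold cross
  field_simp
  ring

/-! ### Stage A: the upper envelope of lines — between two distinct unique tops lies a tie -/

theorem exists_tie_between {σ : ℝ} (_hσ : σ = 1 ∨ σ = -1) (S : Finset Expo) {p p' : Expo} {l l' : ℝ}
    (hll : l < l') (hp : IsUTop (dir σ l) S p) (hp' : IsUTop (dir σ l') S p') (hne : p ≠ p') :
    ∃ μ, l < μ ∧ μ < l' ∧ TieIn (dir σ μ) S := by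
  have gp'l : 0 < wt (dir σ l) p - wt (dir σ l) p' := sub_pos.mpr (hp.2 p' hp'.1 (Ne.symm hne))
  have gp'l' : wt (dir σ l') p - wt (dir σ l') p' < 0 := sub_neg.mpr (hp'.2 p hp.1 hne)
  -- slope of g_{p'} is (p0 − p'0),必 negative
  have hslope : p 0 < p' 0 := by
    by_contra h; push Not at h
    have h' : ((p' 0 : ℕ) : ℝ) ≤ ((p 0 : ℕ) : ℝ) := by exact_mod_cast h
    rw [wt_sub_eq] at gp'l gp'l'
    nlinarith
  set Q := S.filter (fun q => p 0 < q 0) with hQ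
  have hp'Q : p' ∈ Q := Finset.mem_filter.mpr ⟨hp'.1, hslope⟩
  set C := Q.image (cross σ p) with hC
  have hCne : C.Nonempty := ⟨_, Finset.mem_image_of_mem _ hp'Q⟩
  -- key facts for q with q0 > p0
  have key : ∀ q ∈ Q, l < cross σ p q ∧
      ∀ x, x ≤ cross σ p q → 0 ≤ wt (dir σ x) p - wt (dir σ x) q := by
    intro q hq
    obtain ⟨hqS, hq0⟩ := Finset.mem_filter.mp hq
    have hne0 : p 0 ≠ q 0 := Nat.ne_of_lt hq0
    have hA : (((p 0 : ℕ) : ℝ) - ((q 0 : ℕ) : ℝ)) < 0 := by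
      have : ((p 0 : ℕ) : ℝ) < ((q 0 : ℕ) : ℝ) := by exact_mod_cast hq0
      linarith
    have hqp : q ≠ p := by rintro rfl; exact lt_irrefl _ hq0
    have gl : 0 < wt (dir σ l) p - wt (dir σ l) q := sub_pos.mpr (hp.2 q hqS hqp)
    rw [wt_sub_eq_cross l hne0] at gl
    refine ⟨?_, ?_⟩
    · by_contra h; push Not at h
      have : (l - cross σ p q) * (((p 0 : ℕ) : ℝ) - ((q 0 : ℕ) : ℝ)) ≤ 0 :=
        mul_nonpos_of_nonneg_of_nonpos (sub_nonneg.mpr h) hA.le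
      linarith
    · intro x hx
      rw [wt_sub_eq_cross x hne0]
      exact mul_nonneg_of_nonpos_of_nonpos (sub_nonpos.mpr hx) hA.le
  set μ := C.min' hCne with hμ
  obtain ⟨qs, hqsQ, hqs⟩ := Finset.mem_image.mp (C.min'_mem hCne)
  have hqsμ : cross σ p qs = μ := by rw [hqs, hμ]
  have hqsS : qs ∈ S := (Finset.mem_filter.mp hqsQ).1
  have hqs0 : p 0 < qs 0 := (Finset.mem_filter.mp hqsQ).2
  refine ⟨μ, ?_, ?_, ?_⟩
  · rw [← hqsμ]; exact (key qs hqsQ).1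
  · -- μ ≤ cross p p' < l'
    have h1 : μ ≤ cross σ p p' := C.min'_le _ (Finset.mem_image_of_mem _ hp'Q)
    have hne0 : p 0 ≠ p' 0 := Nat.ne_of_lt hslope
    have h2 : cross σ p p' < l' := by
      rw [wt_sub_eq_cross l' hne0] at gp'l'
      by_contra h; push Not at h
      have hA : (((p 0 : ℕ) : ℝ) - ((p' 0 : ℕ) : ℝ)) < 0 := by
        have : ((p 0 : ℕ) : ℝ) < ((p' 0 : ℕ) : ℝ) := by exact_mod_cast hslope
        linarith
      have : 0 ≤ (l' - cross σ p p') * (((p 0 : ℕ) : ℝ) - ((p' 0 : ℕ) : ℝ)) :=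
        mul_nonneg_of_nonpos_of_nonpos (sub_nonpos.mpr h) hA.le
      linarith
    linarith
  · refine ⟨p, hp.1, qs, hqsS, ?_, ?_, ?_⟩
    · rintro rfl; exact lt_irrefl _ hqs0
    · intro r hr
      by_cases hr0 : p 0 < r 0
      · have hrQ : r ∈ Q := Finset.mem_filter.mpr ⟨hr, hr0⟩
        have hle : μ ≤ cross σ p r := C.min'_le _ (Finset.mem_image_of_mem _ hrQ)
        have := (key r hrQ).2 μ hle
        linarith
      · push Not at hr0
        by_cases hrp : r = p
        · rw [hrp]
        · have gl : 0 < wt (dir σ l) p - wt (dir σ l) r := sub_pos.mpr (hp.2 r hr hrp)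
          have hμl : l < μ := by rw [← hqsμ]; exact (key qs hqsQ).1
          have hA : 0 ≤ (((p 0 : ℕ) : ℝ) - ((r 0 : ℕ) : ℝ)) := by
            have : ((r 0 : ℕ) : ℝ) ≤ ((p 0 : ℕ) : ℝ) := by exact_mod_cast hr0
            linarith
          have e1 := wt_sub_eq σ l p r
          have e2 := wt_sub_eq σ μ p r
          nlinarith
    · have hne0 : p 0 ≠ qs 0 := Nat.ne_of_lt hqs0
      have := wt_sub_eq_cross (σ := σ) μ hne0
      rw [hqsμ, sub_self, zero_mul] at this
      linarith

/-- counting unique tops in a chart: at most `#ties + 1` -/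
theorem card_utop_le {σ : ℝ} (hσ : σ = 1 ∨ σ = -1) (S : Finset Expo) (E : Finset ℝ)
    (hE : ∀ μ, TieIn (dir σ μ) S → μ ∈ E) (T : Finset Expo)
    (hT : ∀ p ∈ T, ∃ l, IsUTop (dir σ l) S p) : T.card ≤ E.card + 1 := by
  choose! lam hlam using hT
  let g : Expo → WithTop ℝ := fun p => (E.filter (fun μ => lam p < μ)).min
  have hg_mem : ∀ p ∈ T, g p ∈ insert ⊤ (E.image (fun μ : ℝ => (μ : WithTop ℝ))) := by
    intro p _
    rcases h : g p with _ | a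
    · exact Finset.mem_insert_self _ _
    · apply Finset.mem_insert_of_mem
      have ha : a ∈ E.filter (fun μ => lam p < μ) := Finset.mem_of_min h
      exact Finset.mem_image_of_mem _ (Finset.mem_filter.mp ha).1
  have hg_gt : ∀ p, ((lam p : ℝ) : WithTop ℝ) < g p := by
    intro p
    rcases h : g p with _ | a
    · exact WithTop.coe_lt_top _
    · have ha : a ∈ E.filter (fun μ => lam p < μ) := Finset.mem_of_min h
      exact WithTop.coe_lt_coe.mpr (Finset.mem_filter.mp ha).2
  have hlt : ∀ p ∈ T, ∀ p' ∈ T, p ≠ p' → lam p < lam p' → g p < g p' := by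
    intro p hp p' hp' hne h
    obtain ⟨μ, h1, h2, htie⟩ := exists_tie_between hσ S h (hlam p hp) (hlam p' hp') hne
    have hgp : g p ≤ (μ : WithTop ℝ) := Finset.min_le (Finset.mem_filter.mpr ⟨hE μ htie, h1⟩)
    have : (μ : WithTop ℝ) < g p' :=
      lt_trans (WithTop.coe_lt_coe.mpr h2) (hg_gt p')
    exact lt_of_le_of_lt hgp this
  have hinj : Set.InjOn g T := by
    intro p hp p' hp' hgg
    by_contra hne
    rcases lt_trichotomy (lam p) (lam p') with h | h | h
    · exact absurd hgg (ne_of_lt (hlt p hp p' hp' hne h))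
    · have e1 := hlam p hp
      rw [h] at e1
      exact hne (utop_unique e1 (hlam p' hp'))
    · exact absurd hgg.symm (ne_of_lt (hlt p' hp' p hp (Ne.symm hne) h))
  calc T.card ≤ (insert ⊤ (E.image (fun μ : ℝ => (μ : WithTop ℝ)))).card :=
        Finset.card_le_card_of_injOn g (fun p hp => hg_mem p hp) hinj
    _ ≤ (E.image (fun μ : ℝ => (μ : WithTop ℝ))).card + 1 := Finset.card_insert_le _ _
    _ ≤ E.card + 1 := by
        have := Finset.card_image_le (s := E) (f := fun μ : ℝ => (μ : WithTop ℝ)); omega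

/-! ### Stage C: polynomial-level notions, the exceptional set of `w₁`, specials -/

theorem isEdgeDir_iff_tie (ν : Fin 2 → ℝ) (F : Poly2) : IsEdgeDir ν F ↔ TieIn ν F.support := Iff.rfl

theorem special_tie {ν : Fin 2 → ℝ} {F : Poly2} {e : Expo} (h : IsSpecial ν F e) : TieIn ν F.support := by
  obtain ⟨p, hp, q, hq, hpq, hmax, hqp, -, -⟩ := h
  exact ⟨p, hp, q, hq, hpq, hmax, hqp⟩

theorem special_axis_top {ν : Fin 2 → ℝ} {F : Poly2} {e : Expo} (h : IsSpecial ν F e) :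
    ∃ a ∈ F.support, OnAxis a e ∧ ∀ r ∈ F.support, wt ν r ≤ wt ν a := by
  obtain ⟨p, hp, q, hq, _, hmax, hqp, -, hax⟩ := h
  rcases hax with ha | ha
  · exact ⟨p, hp, ha, hmax⟩
  · exact ⟨q, hq, ha, fun r hr => hqp ▸ hmax r hr⟩

/-- the non-zero exponents of `w` -/
def S1 (w : Poly2) : Finset Expo := w.support.filter (fun s => s ≠ 0)

theorem mem_S1 {w : Poly2} {s : Expo} : s ∈ S1 w ↔ s ∈ w.support ∧ s ≠ 0 := Finset.mem_filter

/-- the EXCEPTIONAL chart values of `w`: pair crossings of non-zero exponents and axis-orthogonality values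
(crude version of memo Lemma 1: `≤ t² + t` values instead of `≤ 4t − 1` directions). -/
def Xc (σ : ℝ) (w : Poly2) : Finset ℝ :=
  (((S1 w) ×ˢ (S1 w)).filter (fun x => x.1 0 ≠ x.2 0)).image (fun x => cross σ x.1 x.2) ∪
  ((S1 w).filter (fun e => e 0 ≠ 0)).image (fun e => -σ * ((e 1 : ℕ) : ℝ) / ((e 0 : ℕ) : ℝ))

theorem card_Xc_le (σ : ℝ) (w : Poly2) :
    (Xc σ w).card ≤ w.support.card * w.support.card + w.support.card := by
  have hS : (S1 w).card ≤ w.support.card := Finset.card_filter_le _ _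
  unfold Xc
  refine (Finset.card_union_le _ _).trans ?_
  refine add_le_add ?_ ?_
  · refine Finset.card_image_le.trans ((Finset.card_filter_le _ _).trans ?_)
    rw [Finset.card_product]
    exact Nat.mul_le_mul hS hS
  · exact Finset.card_image_le.trans ((Finset.card_filter_le _ _).trans hS)

theorem tie_mem_Xc {σ : ℝ} (hσ : σ = 1 ∨ σ = -1) {w : Poly2} {μ : ℝ} (h : TieIn (dir σ μ) (S1 w)) :
    μ ∈ Xc σ w := by
  obtain ⟨p, hp, q, hq, hpq, -, hqp⟩ := h
  have h0 : q 0 ≠ p 0 := fun h0 => hpq (eq_of_wt_eq hσ h0 hqp).symm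
  have hμ : μ = cross σ q p := wt_eq_imp_cross h0 hqp
  unfold Xc
  apply Finset.mem_union_left
  rw [Finset.mem_image]
  exact ⟨(q, p), Finset.mem_filter.mpr ⟨Finset.mem_product.mpr ⟨hq, hp⟩, h0⟩, hμ.symm⟩

theorem axis_mem_Xc {σ : ℝ} {w : Poly2} {e : Expo} (he : e ∈ S1 w) (he0 : e 0 ≠ 0) :
    -σ * ((e 1 : ℕ) : ℝ) / ((e 0 : ℕ) : ℝ) ∈ Xc σ w := by
  unfold Xc
  apply Finset.mem_union_right
  rw [Finset.mem_image]
  exact ⟨e, Finset.mem_filter.mpr ⟨he, he0⟩, rfl⟩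

theorem wt_lead_factor (σ x : ℝ) {e : Expo} (he0 : e 0 ≠ 0) :
    wt (dir σ x) e = ((e 0 : ℕ) : ℝ) * (x - (-σ * ((e 1 : ℕ) : ℝ) / ((e 0 : ℕ) : ℝ))) := by
  have h : ((e 0 : ℕ) : ℝ) ≠ 0 := by exact_mod_cast he0
  rw [wt_dir]
  field_simp
  ring

/-- memo Lemma 1 (existence half): outside the exceptional values, `w` has an axial lead -/
theorem axialLead_of_not_mem {σ : ℝ} (hσ : σ = 1 ∨ σ = -1) {w : Poly2} (hS : (S1 w).Nonempty)
    {l : ℝ} (hl : l ∉ Xc σ w) : ∃ e, IsAxialLead (dir σ l) w e := by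
  obtain ⟨e, heS, hmax⟩ := Finset.exists_max_image (S1 w) (wt (dir σ l)) hS
  obtain ⟨hew, he0⟩ := mem_S1.mp heS
  refine ⟨e, hew, he0, ?_, ?_⟩
  · intro hw0
    by_cases h0 : e 0 = 0
    · -- then σ e1 = 0, so e = 0
      rw [wt_dir, h0] at hw0
      have : ((e 1 : ℕ) : ℝ) = 0 := by
        have h1 : σ * ((e 1 : ℕ) : ℝ) = 0 := by simpa using hw0
        rcases mul_eq_zero.mp h1 with h | h
        · exact absurd h (sigma_ne_zero hσ)
        · exact h
      have h1 : e 1 = 0 := by exact_mod_cast this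
      exact he0 (expo_eq_of_coords (by simpa using h0) (by simpa using h1))
    · apply hl
      have hf := wt_lead_factor σ l h0
      rw [hw0] at hf
      have h0r : ((e 0 : ℕ) : ℝ) ≠ 0 := by exact_mod_cast h0
      have : l = -σ * ((e 1 : ℕ) : ℝ) / ((e 0 : ℕ) : ℝ) := by
        rcases mul_eq_zero.mp hf.symm with h | h
        · exact absurd h h0r
        · linarith
      rw [this]; exact axis_mem_Xc heS h0
  · intro s hs hs0 hse
    have hsS : s ∈ S1 w := mem_S1.mpr ⟨hs, hs0⟩
    rcases (hmax s hsS).lt_or_eq with h | h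
    · exact h
    · exfalso
      by_cases h0 : s 0 = e 0
      · exact hse (eq_of_wt_eq hσ h0 h)
      · exact hl (wt_eq_imp_cross h0 h ▸ (by
          unfold Xc; apply Finset.mem_union_left; rw [Finset.mem_image]
          exact ⟨(s, e), Finset.mem_filter.mpr ⟨Finset.mem_product.mpr ⟨hsS, heS⟩, h0⟩, rfl⟩))

theorem lead_utop {ν : Fin 2 → ℝ} {w : Poly2} {e : Expo} (h : IsAxialLead ν w e) : IsUTop ν (S1 w) e := by
  obtain ⟨hew, he0, -, hdom⟩ := h
  exact ⟨mem_S1.mpr ⟨hew, he0⟩, fun r hr hre => hdom r (mem_S1.mp hr).1 (mem_S1.mp hr).2 hre⟩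

/-- chart edge values of `F` (a superset of the tie values) and the tie set itself -/
def EV (σ : ℝ) (F : Poly2) : Finset ℝ :=
  ((F.support ×ˢ F.support).filter (fun x => x.1 0 ≠ x.2 0)).image (fun x => cross σ x.1 x.2)

theorem mem_EV_of_tie {σ : ℝ} (hσ : σ = 1 ∨ σ = -1) {F : Poly2} {μ : ℝ} (h : TieIn (dir σ μ) F.support) :
    μ ∈ EV σ F := by
  obtain ⟨p, hp, q, hq, hpq, -, hqp⟩ := h
  have h0 : q 0 ≠ p 0 := fun h0 => hpq (eq_of_wt_eq hσ h0 hqp).symm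
  have hμ : μ = cross σ q p := wt_eq_imp_cross h0 hqp
  unfold EV; rw [Finset.mem_image]
  exact ⟨(q, p), Finset.mem_filter.mpr ⟨Finset.mem_product.mpr ⟨hq, hp⟩, h0⟩, hμ.symm⟩

theorem card_EV_le (σ : ℝ) (F : Poly2) : (EV σ F).card ≤ F.support.card * F.support.card := by
  unfold EV
  refine Finset.card_image_le.trans ((Finset.card_filter_le _ _).trans ?_)
  rw [Finset.card_product]

def Eset (σ : ℝ) (F : Poly2) : Finset ℝ := (EV σ F).filter (fun μ => TieIn (dir σ μ) F.support)

theorem mem_Eset {σ : ℝ} (hσ : σ = 1 ∨ σ = -1) {F : Poly2} {μ : ℝ} :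
    μ ∈ Eset σ F ↔ IsEdgeDir (dir σ μ) F := by
  unfold Eset; rw [Finset.mem_filter, isEdgeDir_iff_tie]
  exact ⟨fun h => h.2, fun h => ⟨mem_EV_of_tie hσ h, h⟩⟩

theorem card_Eset_le (σ : ℝ) (F : Poly2) : (Eset σ F).card ≤ F.support.card * F.support.card :=
  (Finset.card_filter_le _ _).trans (card_EV_le σ F)

theorem Eset_zero (σ : ℝ) : Eset σ (0 : Poly2) = ∅ := by
  unfold Eset EV; simp

/-- special chart values of `F` relative to `w` (outside the exceptional set) -/
def Spec (σ : ℝ) (w F : Poly2) : Finset ℝ :=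
  (EV σ F).filter (fun μ => μ ∉ Xc σ w ∧ ∃ e, IsAxialLead (dir σ μ) w e ∧ IsSpecial (dir σ μ) F e)

/-- gap index -/
def idx (σ : ℝ) (w : Poly2) (μ : ℝ) : ℕ := ((Xc σ w).filter (fun z => z < μ)).card

theorem idx_le (σ : ℝ) (w : Poly2) (μ : ℝ) : idx σ w μ ≤ (Xc σ w).card := Finset.card_filter_le _ _

theorem gap_of_idx_eq {σ : ℝ} {w : Poly2} {x y : ℝ} (_hxy : x < y) (h : idx σ w x = idx σ w y) :
    ∀ z ∈ Xc σ w, ¬ (x < z ∧ z < y) := by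
  rintro z hz ⟨hxz, hzy⟩
  have hsub : (Xc σ w).filter (fun z => z < x) ⊂ (Xc σ w).filter (fun z => z < y) := by
    rw [Finset.ssubset_iff_of_subset]
    · exact ⟨z, Finset.mem_filter.mpr ⟨hz, hzy⟩, fun h => by
        have := (Finset.mem_filter.mp h).2; linarith⟩
    · intro u hu
      obtain ⟨hu1, hu2⟩ := Finset.mem_filter.mp hu
      exact Finset.mem_filter.mpr ⟨hu1, by linarith⟩
  have := Finset.card_lt_card hsub
  unfold idx at h
  omega

theorem lead_eq_of_gap {σ : ℝ} (hσ : σ = 1 ∨ σ = -1) {w : Poly2} {x y : ℝ} (hxy : x < y)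
    (hgap : ∀ z ∈ Xc σ w, ¬ (x < z ∧ z < y)) {e e' : Expo} (he : IsUTop (dir σ x) (S1 w) e)
    (he' : IsUTop (dir σ y) (S1 w) e') : e = e' := by
  by_contra hne
  obtain ⟨μ, h1, h2, htie⟩ := exists_tie_between hσ (S1 w) hxy he he' hne
  exact hgap μ (tie_mem_Xc hσ htie) ⟨h1, h2⟩

theorem sameSign {σ : ℝ} {w : Poly2} {x y : ℝ} (hxy : x < y)
    (hgap : ∀ z ∈ Xc σ w, ¬ (x < z ∧ z < y)) {e : Expo} (heS : e ∈ S1 w)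
    (hx : wt (dir σ x) e ≠ 0) (_hy : wt (dir σ y) e ≠ 0) :
    (0 < wt (dir σ x) e ↔ 0 < wt (dir σ y) e) := by
  by_cases he0 : e 0 = 0
  · -- weight is constant in the chart
    have : wt (dir σ x) e = wt (dir σ y) e := by rw [wt_dir, wt_dir, he0]; simp
    rw [this]
  · set z := -σ * ((e 1 : ℕ) : ℝ) / ((e 0 : ℕ) : ℝ) with hz
    have hzX : z ∈ Xc σ w := axis_mem_Xc heS he0
    have fx := wt_lead_factor σ x he0
    have fy := wt_lead_factor σ y he0
    have he0pos : (0 : ℝ) < ((e 0 : ℕ) : ℝ) := by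
      have : 0 < e 0 := Nat.pos_of_ne_zero he0
      exact_mod_cast this
    constructor
    · intro hxpos
      -- x > z, hence y > z, hence wt_y > 0
      have hxz : z < x := by
        by_contra h; push Not at h
        have : wt (dir σ x) e ≤ 0 := by rw [fx]; exact mul_nonpos_of_nonneg_of_nonpos he0pos.le (by linarith)
        linarith
      rw [fy]; exact mul_pos he0pos (by linarith)
    · intro hypos
      have hzy : z < y := by
        by_contra h; push Not at h
        have : wt (dir σ y) e ≤ 0 := by rw [fy]; exact mul_nonpos_of_nonneg_of_nonpos he0pos.le (by linarith)
        linarith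
      -- if wt_x ≤ 0 then x ≤ z, and x ≠ z... : x < z < y contradicts the gap (x = z impossible as wt_x ≠ 0)
      by_contra hxnp; push Not at hxnp
      have hxz : x < z := by
        rcases lt_trichotomy x z with h | h | h
        · exact h
        · exfalso; apply hx; rw [fx, h]; ring
        · exfalso
          have : 0 < wt (dir σ x) e := by rw [fx]; exact mul_pos he0pos (by linarith)
          linarith
      exact hgap z hzX ⟨hxz, hzy⟩

theorem wt_mul_of_onAxis (ν : Fin 2 → ℝ) {a e : Expo} (h : OnAxis a e) (i : Fin 2) :
    wt ν a * ((e i : ℕ) : ℝ) = ((a i : ℕ) : ℝ) * wt ν e := by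
  unfold OnAxis at h
  have hr : ((a 0 : ℕ) : ℝ) * ((e 1 : ℕ) : ℝ) = ((a 1 : ℕ) : ℝ) * ((e 0 : ℕ) : ℝ) := by exact_mod_cast h
  unfold wt
  fin_cases i
  · simp only [Fin.zero_eta, Fin.isValue]; linear_combination (-(ν 1)) * hr
  · simp only [Fin.mk_one, Fin.isValue]; linear_combination (ν 0) * hr

theorem eq_of_onAxis_coord {a a' e : Expo} (ha : OnAxis a e) (ha' : OnAxis a' e) {i : Fin 2}
    (hei : e i ≠ 0) (hi : a i = a' i) : a = a' := by
  unfold OnAxis at ha ha'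
  fin_cases i
  · -- e 0 ≠ 0, a 0 = a' 0 ⇒ a 1 e0 = a0 e1 = a'0 e1 = a'1 e0
    simp only [Fin.zero_eta, Fin.isValue] at hei hi
    refine expo_eq_of_coords hi ?_
    have h : ((a 1 : ℕ) : ℤ) * ((e 0 : ℕ) : ℤ) = ((a' 1 : ℕ) : ℤ) * ((e 0 : ℕ) : ℤ) := by
      rw [← ha, ← ha', hi]
    have he : ((e 0 : ℕ) : ℤ) ≠ 0 := by exact_mod_cast hei
    exact_mod_cast mul_right_cancel₀ he h
  · simp only [Fin.mk_one, Fin.isValue] at hei hi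
    refine expo_eq_of_coords ?_ hi
    have h : ((a 0 : ℕ) : ℤ) * ((e 1 : ℕ) : ℤ) = ((a' 0 : ℕ) : ℤ) * ((e 1 : ℕ) : ℤ) := by
      rw [ha, ha', hi]
    have he : ((e 1 : ℕ) : ℤ) ≠ 0 := by exact_mod_cast hei
    exact_mod_cast mul_right_cancel₀ he h

/-- on one gap, all specials share their axis point -/
theorem axisPoint_eq {σ : ℝ} {w F : Poly2} {x y : ℝ} (hxy : x < y)
    (hgap : ∀ z ∈ Xc σ w, ¬ (x < z ∧ z < y)) {e : Expo} (hex : IsAxialLead (dir σ x) w e)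
    (hey : IsAxialLead (dir σ y) w e) {a a' : Expo} (ha : OnAxis a e) (ha' : OnAxis a' e)
    (haS : a ∈ F.support) (ha'S : a' ∈ F.support)
    (hatop : ∀ r ∈ F.support, wt (dir σ x) r ≤ wt (dir σ x) a)
    (ha'top : ∀ r ∈ F.support, wt (dir σ y) r ≤ wt (dir σ y) a') : a = a' := by
  obtain ⟨heS, he0, hWx, -⟩ := hex
  obtain ⟨-, -, hWy, -⟩ := hey
  have heS1 : e ∈ S1 w := mem_S1.mpr ⟨heS, he0⟩
  have hsign := sameSign hxy hgap heS1 hWx hWy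
  -- pick a coordinate i with e i ≠ 0
  have hei : ∃ i : Fin 2, e i ≠ 0 := by
    by_contra h; push Not at h
    exact he0 (expo_eq_of_coords (by simpa using h 0) (by simpa using h 1))
  obtain ⟨i, hei⟩ := hei
  have heipos : (0 : ℝ) < ((e i : ℕ) : ℝ) := by
    have : 0 < e i := Nat.pos_of_ne_zero hei; exact_mod_cast this
  have m1 := wt_mul_of_onAxis (dir σ x) ha i
  have m1' := wt_mul_of_onAxis (dir σ x) ha' i
  have m2 := wt_mul_of_onAxis (dir σ y) ha i
  have m2' := wt_mul_of_onAxis (dir σ y) ha' i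
  have i1 := hatop a' ha'S   -- wt_x a' ≤ wt_x a
  have i2 := ha'top a haS    -- wt_y a ≤ wt_y a'
  -- multiply by e_i > 0:  a'_i W_x ≤ a_i W_x  and  a_i W_y ≤ a'_i W_y
  have j1 : ((a' i : ℕ) : ℝ) * wt (dir σ x) e ≤ ((a i : ℕ) : ℝ) * wt (dir σ x) e := by
    rw [← m1, ← m1']; exact mul_le_mul_of_nonneg_right i1 heipos.le
  have j2 : ((a i : ℕ) : ℝ) * wt (dir σ y) e ≤ ((a' i : ℕ) : ℝ) * wt (dir σ y) e := by
    rw [← m2, ← m2']; exact mul_le_mul_of_nonneg_right i2 heipos.le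
  have hcoord : ((a i : ℕ) : ℝ) = ((a' i : ℕ) : ℝ) := by
    rcases lt_or_gt_of_ne hWx with hneg | hpos
    · have hneg' : wt (dir σ y) e < 0 := by
        rcases lt_or_gt_of_ne hWy with h | h
        · exact h
        · exact absurd (hsign.mpr h) (not_lt.mpr hneg.le)
      have k1 : ((a i : ℕ) : ℝ) ≤ ((a' i : ℕ) : ℝ) := by nlinarith
      have k2 : ((a' i : ℕ) : ℝ) ≤ ((a i : ℕ) : ℝ) := by nlinarith
      linarith
    · have hpos' : 0 < wt (dir σ y) e := hsign.mp hpos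
      have k1 : ((a' i : ℕ) : ℝ) ≤ ((a i : ℕ) : ℝ) := le_of_mul_le_mul_right j1 hpos
      have k2 : ((a i : ℕ) : ℝ) ≤ ((a' i : ℕ) : ℝ) := le_of_mul_le_mul_right j2 hpos'
      linarith
  have : a i = a' i := by exact_mod_cast hcoord
  exact eq_of_onAxis_coord ha ha' hei this

/-- C4: a point that is a top at two chart values is the UNIQUE top strictly in between -/
theorem utop_between {σ : ℝ} (hσ : σ = 1 ∨ σ = -1) {F : Poly2} {x m y : ℝ} (hxm : x < m) (hmy : m < y)
    {a : Expo} (haS : a ∈ F.support) (hx : ∀ r ∈ F.support, wt (dir σ x) r ≤ wt (dir σ x) a)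
    (hy : ∀ r ∈ F.support, wt (dir σ y) r ≤ wt (dir σ y) a) : IsUTop (dir σ m) F.support a := by
  refine ⟨haS, fun r hr hra => ?_⟩
  have e1 := wt_sub_eq σ x r a
  have e2 := wt_sub_eq σ m r a
  have e3 := wt_sub_eq σ y r a
  have g1 : wt (dir σ x) r - wt (dir σ x) a ≤ 0 := sub_nonpos.mpr (hx r hr)
  have g3 : wt (dir σ y) r - wt (dir σ y) a ≤ 0 := sub_nonpos.mpr (hy r hr)
  set A := ((r 0 : ℕ) : ℝ) - ((a 0 : ℕ) : ℝ) with hA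
  set B := σ * (((r 1 : ℕ) : ℝ) - ((a 1 : ℕ) : ℝ)) with hB
  by_contra hge; push Not at hge
  have g2 : 0 ≤ wt (dir σ m) r - wt (dir σ m) a := sub_nonneg.mpr hge
  -- x A + B ≤ 0, y A + B ≤ 0, m A + B ≥ 0 with x < m < y ⇒ A = 0 and B = 0
  have hA0 : A = 0 := by
    rcases lt_trichotomy A 0 with h | h | h
    · nlinarith
    · exact h
    · nlinarith
  have hB0 : B = 0 := by rw [e2, hA0] at g2; rw [e1, hA0] at g1; linarith
  have h0 : r 0 = a 0 := by
    have : ((r 0 : ℕ) : ℝ) = ((a 0 : ℕ) : ℝ) := by linarith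
    exact_mod_cast this
  have h1 : r 1 = a 1 := by
    have : σ * (((r 1 : ℕ) : ℝ) - ((a 1 : ℕ) : ℝ)) = 0 := hB0
    rcases mul_eq_zero.mp this with h | h
    · exact absurd h (sigma_ne_zero hσ)
    · have : ((r 1 : ℕ) : ℝ) = ((a 1 : ℕ) : ℝ) := by linarith
      exact_mod_cast this
  exact hra (expo_eq_of_coords h0 h1)

/-- at most two specials per gap -/
theorem spec_fibre_le_two {σ : ℝ} (hσ : σ = 1 ∨ σ = -1) (w F : Poly2) (b : ℕ) :
    ((Spec σ w F).filter (fun μ => idx σ w μ = b)).card ≤ 2 := by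
  by_contra h3; push Not at h3
  set f := (Spec σ w F).filter (fun μ => idx σ w μ = b) with hf
  have hne : f.Nonempty := Finset.card_pos.mp (by omega)
  set x := f.min' hne with hx
  set y := f.max' hne with hy
  have hxf : x ∈ f := Finset.min'_mem f hne
  have hyf : y ∈ f := Finset.max'_mem f hne
  have hcard : ((f.erase x).erase y).card ≥ 1 := by
    have h1 := Finset.card_erase_of_mem hxf
    have h2 : ((f.erase x).erase y).card ≥ (f.erase x).card - 1 := by
      by_cases hy' : y ∈ f.erase x
      · rw [Finset.card_erase_of_mem hy']
      · rw [Finset.erase_eq_of_notMem hy']; omega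
    omega
  obtain ⟨m, hm⟩ := Finset.card_pos.mp (by omega : 0 < ((f.erase x).erase y).card)
  have hmy : m ≠ y := Finset.ne_of_mem_erase hm
  have hm' := Finset.mem_of_mem_erase hm
  have hmx : m ≠ x := Finset.ne_of_mem_erase hm'
  have hmf : m ∈ f := Finset.mem_of_mem_erase hm'
  have hxm : x < m := lt_of_le_of_ne (Finset.min'_le f m hmf) (Ne.symm hmx)
  have hmy' : m < y := lt_of_le_of_ne (Finset.le_max' f m hmf) hmy
  -- unpack the three specials
  have unpack : ∀ u ∈ f, idx σ w u = b ∧ u ∉ Xc σ w ∧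
      ∃ e, IsAxialLead (dir σ u) w e ∧ IsSpecial (dir σ u) F e := by
    intro u hu
    obtain ⟨hu1, hu2⟩ := Finset.mem_filter.mp hu
    obtain ⟨-, hu3, hu4⟩ := Finset.mem_filter.mp hu1
    exact ⟨hu2, hu3, hu4⟩
  obtain ⟨ix, -, ex, hlx, hsx⟩ := unpack x hxf
  obtain ⟨im, -, em, hlm, hsm⟩ := unpack m hmf
  obtain ⟨iy, -, ey, hly, hsy⟩ := unpack y hyf
  have gap_xm := gap_of_idx_eq hxm (ix.trans im.symm)
  have gap_my := gap_of_idx_eq hmy' (im.trans iy.symm)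
  have exm : ex = em := lead_eq_of_gap hσ hxm gap_xm (lead_utop hlx) (lead_utop hlm)
  have emy : em = ey := lead_eq_of_gap hσ hmy' gap_my (lead_utop hlm) (lead_utop hly)
  subst exm; subst emy
  obtain ⟨ax, haxS, hax, htx⟩ := special_axis_top hsx
  obtain ⟨am, hamS, ham, htm⟩ := special_axis_top hsm
  obtain ⟨ay, hayS, hay, hty⟩ := special_axis_top hsy
  have e1 : ax = am := axisPoint_eq hxm gap_xm hlx hlm hax ham haxS hamS htx htm
  have e2 : am = ay := axisPoint_eq hmy' gap_my hlm hly ham hay hamS hayS htm hty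
  subst e1; subst e2
  have hu := utop_between hσ hxm hmy' haxS htx hty
  exact not_tie_of_utop hu (special_tie hsm)

theorem card_Spec_le {σ : ℝ} (hσ : σ = 1 ∨ σ = -1) (w F : Poly2) :
    (Spec σ w F).card ≤ 2 * ((Xc σ w).card + 1) := by
  have h1 : (Spec σ w F).card ≤ 2 * ((Spec σ w F).image (idx σ w)).card :=
    Finset.card_le_mul_card_image _ 2 (fun b _ => spec_fibre_le_two hσ w F b)
  have h2 : ((Spec σ w F).image (idx σ w)).card ≤ (Xc σ w).card + 1 := by
    have hsub : (Spec σ w F).image (idx σ w) ⊆ Finset.range ((Xc σ w).card + 1) := by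
      intro b hb
      obtain ⟨μ, -, rfl⟩ := Finset.mem_image.mp hb
      exact Finset.mem_range.mpr (Nat.lt_succ_of_le (idx_le σ w μ))
    exact (Finset.card_le_card hsub).trans (by simp)
  calc (Spec σ w F).card ≤ 2 * ((Spec σ w F).image (idx σ w)).card := h1
    _ ≤ 2 * ((Xc σ w).card + 1) := Nat.mul_le_mul_left 2 h2


/-! ### Stage D: the tower induction (abstract in the three kernel lemmas) -/

theorem ne_zero_of_isEdgeDir {ν : Fin 2 → ℝ} {F : Poly2} (h : IsEdgeDir ν F) : F ≠ 0 := by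
  rintro rfl
  obtain ⟨p, hp, -⟩ := h
  simp at hp

theorem support_pderiv_deg {Q : Poly2} {s : Expo} (hs : s ∈ (pderiv 1 Q).support) :
    s + Finsupp.single 1 1 ∈ Q.support := by
  rw [MvPolynomial.mem_support_iff, coeff_pderiv] at hs
  rw [MvPolynomial.mem_support_iff]
  intro h; apply hs; rw [h, zero_mul]

section Tower
variable {σ : ℝ} (hσ : σ = 1 ∨ σ = -1) (w₁ w₂ J : Poly2) (Jf : Poly2 → Poly2)
  (hAT : ∀ (ν : Fin 2 → ℝ) (F : Poly2) (e : Expo), F ≠ 0 → IsAxialLead ν w₁ e → IsEdgeDir ν F →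
    IsSpecial ν F e ∨ IsEdgeDir ν (Jf F))
  (hCR : ∀ Q : Poly2, Jf (aeval ![w₁, w₂] Q) = aeval ![w₁, w₂] (pderiv 1 Q) * J)
  (hO : ∀ (ν : Fin 2 → ℝ) (F G : Poly2), F ≠ 0 → G ≠ 0 →
    (IsEdgeDir ν (F * G) ↔ IsEdgeDir ν F ∨ IsEdgeDir ν G))
include hσ hAT hCR hO

theorem Eset_step (hS : (S1 w₁).Nonempty) (Q : Poly2) :
    Eset σ (aeval ![w₁, w₂] Q) ⊆
      Xc σ w₁ ∪ Spec σ w₁ (aeval ![w₁, w₂] Q) ∪ Eset σ (aeval ![w₁, w₂] (pderiv 1 Q)) ∪ Eset σ J := by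
  intro μ hμ
  have hedge := (mem_Eset hσ).mp hμ
  by_cases hX : μ ∈ Xc σ w₁
  · exact Finset.mem_union_left _ (Finset.mem_union_left _ (Finset.mem_union_left _ hX))
  obtain ⟨e, hlead⟩ := axialLead_of_not_mem hσ hS hX
  rcases hAT (dir σ μ) _ e (ne_zero_of_isEdgeDir hedge) hlead hedge with hsp | hJ'
  · apply Finset.mem_union_left; apply Finset.mem_union_left; apply Finset.mem_union_right
    unfold Spec
    exact Finset.mem_filter.mpr ⟨mem_EV_of_tie hσ hedge, hX, e, hlead, hsp⟩
  · rw [hCR Q] at hJ'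
    by_cases h1 : aeval ![w₁, w₂] (pderiv 1 Q) = 0
    · exfalso; rw [h1, zero_mul] at hJ'; exact ne_zero_of_isEdgeDir hJ' rfl
    by_cases h2 : J = 0
    · exfalso; rw [h2, mul_zero] at hJ'; exact ne_zero_of_isEdgeDir hJ' rfl
    rcases (hO _ _ _ h1 h2).mp hJ' with h | h
    · apply Finset.mem_union_left; apply Finset.mem_union_right; exact (mem_Eset hσ).mpr h
    · apply Finset.mem_union_right; exact (mem_Eset hσ).mpr h

theorem tower (hS : (S1 w₁).Nonempty) :
    ∀ (n : ℕ) (Q : Poly2), (∀ s ∈ Q.support, s 1 < n) →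
      (Eset σ (aeval ![w₁, w₂] Q)).card ≤ n * (3 * (Xc σ w₁).card + 2 + (Eset σ J).card) := by
  intro n
  induction n with
  | zero =>
    intro Q hQ
    have hQ0 : Q = 0 := by
      by_contra h
      obtain ⟨d, hd⟩ := MvPolynomial.ne_zero_iff.mp h
      exact absurd (hQ d (MvPolynomial.mem_support_iff.mpr hd)) (Nat.not_lt_zero _)
    subst hQ0
    rw [map_zero, Eset_zero]; simp
  | succ n ih =>
    intro Q hQ
    have hQ' : ∀ s ∈ (pderiv 1 Q).support, s 1 < n := by
      intro s hs
      have := hQ _ (support_pderiv_deg hs)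
      simp only [Finsupp.add_apply, Finsupp.single_eq_same] at this
      omega
    have ih' := ih (pderiv 1 Q) hQ'
    have hstep := Eset_step hσ w₁ w₂ J Jf hAT hCR hO hS Q
    have hsp := card_Spec_le hσ w₁ (aeval ![w₁, w₂] Q)
    calc (Eset σ (aeval ![w₁, w₂] Q)).card
        ≤ (Xc σ w₁ ∪ Spec σ w₁ (aeval ![w₁, w₂] Q) ∪ Eset σ (aeval ![w₁, w₂] (pderiv 1 Q)) ∪ Eset σ J).card :=
          Finset.card_le_card hstep
      _ ≤ (Xc σ w₁).card + (Spec σ w₁ (aeval ![w₁, w₂] Q)).card +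
            (Eset σ (aeval ![w₁, w₂] (pderiv 1 Q))).card + (Eset σ J).card := by
          refine (Finset.card_union_le _ _).trans (Nat.add_le_add_right ?_ _)
          refine (Finset.card_union_le _ _).trans (Nat.add_le_add_right ?_ _)
          exact Finset.card_union_le _ _
      _ ≤ (n + 1) * (3 * (Xc σ w₁).card + 2 + (Eset σ J).card) := by nlinarith [hsp, ih']

end Tower

theorem deg1_lt_of_totalDegree (P : Poly2) : ∀ s ∈ P.support, s 1 < P.totalDegree + 1 := by
  intro s hs
  have h1 : s 1 ≤ s.sum (fun _ e => e) := by
    by_cases h : (1 : Fin 2) ∈ s.support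
    · exact Finset.single_le_sum (fun j _ => Nat.zero_le (s j)) h
    · rw [Finsupp.notMem_support_iff.mp h]; exact Nat.zero_le _
  have h2 := le_totalDegree hs
  omega

/-! ### Stage B: vertices are chart-unique tops (or the two horizontal extremes) -/

theorem emb_injective : Function.Injective emb := by
  intro a b h
  ext i
  have := congrFun h i
  simp only [emb] at this
  exact_mod_cast this

def Tset (σ : ℝ) (F : Poly2) : Finset Expo := F.support.filter (fun p => ∃ l, IsUTop (dir σ l) F.support p)
def Hmax (F : Poly2) : Finset Expo := F.support.filter (fun p => ∀ q ∈ F.support, q ≠ p → q 0 < p 0)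
def Hmin (F : Poly2) : Finset Expo := F.support.filter (fun p => ∀ q ∈ F.support, q ≠ p → p 0 < q 0)

theorem card_Hmax_le_one (F : Poly2) : (Hmax F).card ≤ 1 := by
  rw [Finset.card_le_one]
  intro a ha b hb
  obtain ⟨haS, ha'⟩ := Finset.mem_filter.mp ha
  obtain ⟨hbS, hb'⟩ := Finset.mem_filter.mp hb
  by_contra h
  have h1 := ha' b hbS (Ne.symm h)
  have h2 := hb' a haS h
  omega

theorem card_Hmin_le_one (F : Poly2) : (Hmin F).card ≤ 1 := by
  rw [Finset.card_le_one]
  intro a ha b hb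
  obtain ⟨haS, ha'⟩ := Finset.mem_filter.mp ha
  obtain ⟨hbS, hb'⟩ := Finset.mem_filter.mp hb
  by_contra h
  have h1 := ha' b hbS (Ne.symm h)
  have h2 := hb' a haS h
  omega

theorem card_Tset_le {σ : ℝ} (hσ : σ = 1 ∨ σ = -1) (F : Poly2) : (Tset σ F).card ≤ (Eset σ F).card + 1 :=
  card_utop_le hσ F.support (Eset σ F) (fun _ h => (mem_Eset hσ).mpr h) (Tset σ F)
    (fun _ hp => (Finset.mem_filter.mp hp).2)

theorem f_emb (f : (Fin 2 → ℝ) →L[ℝ] ℝ) (q : Expo) :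
    f (emb q) = wt ![f (Pi.single 0 1), f (Pi.single 1 1)] q := by
  have : emb q = ((q 0 : ℕ) : ℝ) • (Pi.single 0 1 : Fin 2 → ℝ) + ((q 1 : ℕ) : ℝ) • (Pi.single 1 1 : Fin 2 → ℝ) := by
    ext i; fin_cases i <;> simp [emb]
  rw [this, map_add, map_smul, map_smul]
  simp [wt]
  ring

theorem extreme_subset (F : Poly2) :
    Set.extremePoints ℝ (convexHull ℝ (emb '' (F.support : Set Expo))) ⊆
      emb '' ((Tset 1 F ∪ Tset (-1) F ∪ Hmax F ∪ Hmin F : Finset Expo) : Set Expo) := by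
  intro v hv
  set S : Set (Fin 2 → ℝ) := emb '' (F.support : Set Expo) with hS
  have hSfin : S.Finite := (F.support.finite_toSet).image emb
  have hvS : v ∈ S := extremePoints_convexHull_subset hv
  obtain ⟨p, hpS, rfl⟩ := hvS
  have hpS' : p ∈ F.support := hpS
  -- v ∉ convexHull (S \ {v})
  have hnot : emb p ∉ convexHull ℝ (S \ {emb p}) := by
    have h := ((convex_convexHull ℝ S).mem_extremePoints_iff_mem_sdiff_convexHull_sdiff).mp hv
    intro hin
    apply h.2
    refine convexHull_mono ?_ hin
    exact Set.sdiff_subset_sdiff_left (subset_convexHull ℝ S)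
  obtain ⟨f, u, hfu, huv⟩ := geometric_hahn_banach_closed_point (convex_convexHull ℝ _)
    ((hSfin.subset Set.sdiff_subset).isClosed_convexHull ℝ) hnot
  set ν : Fin 2 → ℝ := ![f (Pi.single 0 1), f (Pi.single 1 1)] with hν
  have hstrict : ∀ q ∈ F.support, q ≠ p → wt ν q < wt ν p := by
    intro q hq hqp
    have hq' : emb q ∈ convexHull ℝ (S \ {emb p}) := by
      apply subset_convexHull
      refine ⟨⟨q, hq, rfl⟩, ?_⟩
      intro h; exact hqp (emb_injective h)
    have := hfu _ hq'
    rw [← f_emb, ← f_emb]; linarith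
  -- chart reduction
  rw [Finset.coe_union, Finset.coe_union, Finset.coe_union, Set.image_union, Set.image_union, Set.image_union]
  rcases lt_trichotomy (ν 1) 0 with h1 | h1 | h1
  · -- σ = -1, l = ν0 / (-ν1)
    apply Or.inl; apply Or.inl; apply Or.inr
    refine ⟨p, ?_, rfl⟩
    refine Finset.mem_filter.mpr ⟨hpS', ν 0 / (-ν 1), hpS', fun r hr hrp => ?_⟩
    have := hstrict r hr hrp
    unfold wt at this
    rw [wt_dir, wt_dir]
    have hn : 0 < -ν 1 := by linarith
    have hν1 : ν 1 ≠ 0 := ne_of_lt h1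
    rw [← sub_pos]
    have : 0 < (ν 0 * ((p 0 : ℕ) : ℝ) + ν 1 * ((p 1 : ℕ) : ℝ)) - (ν 0 * ((r 0 : ℕ) : ℝ) + ν 1 * ((r 1 : ℕ) : ℝ)) := by linarith
    have key : (ν 0 / -ν 1 * ((p 0 : ℕ) : ℝ) + -1 * ((p 1 : ℕ) : ℝ)) - (ν 0 / -ν 1 * ((r 0 : ℕ) : ℝ) + -1 * ((r 1 : ℕ) : ℝ))
        = ((ν 0 * ((p 0 : ℕ) : ℝ) + ν 1 * ((p 1 : ℕ) : ℝ)) - (ν 0 * ((r 0 : ℕ) : ℝ) + ν 1 * ((r 1 : ℕ) : ℝ))) / (-ν 1) := by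
      field_simp; ring
    rw [key]; exact div_pos this hn
  · -- ν 1 = 0: horizontal
    by_cases h0 : 0 ≤ ν 0
    · apply Or.inl; apply Or.inr
      refine ⟨p, Finset.mem_filter.mpr ⟨hpS', fun q hq hqp => ?_⟩, rfl⟩
      have := hstrict q hq hqp
      unfold wt at this; rw [h1] at this
      simp only [zero_mul, add_zero] at this
      rcases h0.lt_or_eq with h0 | h0
      · have : ((q 0 : ℕ) : ℝ) < ((p 0 : ℕ) : ℝ) := lt_of_mul_lt_mul_left this h0.le
        exact_mod_cast this
      · exfalso; rw [← h0] at this; simp at this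
    · apply Or.inr
      push Not at h0
      refine ⟨p, Finset.mem_filter.mpr ⟨hpS', fun q hq hqp => ?_⟩, rfl⟩
      have := hstrict q hq hqp
      unfold wt at this; rw [h1] at this
      simp only [zero_mul, add_zero] at this
      have : ((p 0 : ℕ) : ℝ) < ((q 0 : ℕ) : ℝ) := by nlinarith
      exact_mod_cast this
  · -- σ = 1, l = ν0 / ν1
    apply Or.inl; apply Or.inl; apply Or.inl
    refine ⟨p, ?_, rfl⟩
    refine Finset.mem_filter.mpr ⟨hpS', ν 0 / ν 1, hpS', fun r hr hrp => ?_⟩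
    have := hstrict r hr hrp
    unfold wt at this
    rw [wt_dir, wt_dir, ← sub_pos]
    have hν1 : ν 1 ≠ 0 := ne_of_gt h1
    have : 0 < (ν 0 * ((p 0 : ℕ) : ℝ) + ν 1 * ((p 1 : ℕ) : ℝ)) - (ν 0 * ((r 0 : ℕ) : ℝ) + ν 1 * ((r 1 : ℕ) : ℝ)) := by linarith
    have key : (ν 0 / ν 1 * ((p 0 : ℕ) : ℝ) + 1 * ((p 1 : ℕ) : ℝ)) - (ν 0 / ν 1 * ((r 0 : ℕ) : ℝ) + 1 * ((r 1 : ℕ) : ℝ))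
        = ((ν 0 * ((p 0 : ℕ) : ℝ) + ν 1 * ((p 1 : ℕ) : ℝ)) - (ν 0 * ((r 0 : ℕ) : ℝ) + ν 1 * ((r 1 : ℕ) : ℝ))) / ν 1 := by
      field_simp
    rw [key]; exact div_pos this h1

theorem nv_le (F : Poly2) : nv F ≤ (Eset 1 F).card + (Eset (-1) F).card + 4 := by
  have hsub := extreme_subset F
  have hfin : (emb '' ((Tset 1 F ∪ Tset (-1) F ∪ Hmax F ∪ Hmin F : Finset Expo) : Set Expo)).Finite :=
    (Finset.finite_toSet _).image emb
  unfold nv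
  refine (Set.ncard_le_ncard hsub hfin).trans ?_
  refine (Set.ncard_image_le (Finset.finite_toSet _)).trans ?_
  rw [Set.ncard_coe_finset]
  have h1 := card_Tset_le (σ := 1) (Or.inl rfl) F
  have h2 := card_Tset_le (σ := -1) (Or.inr rfl) F
  have h3 := card_Hmax_le_one F
  have h4 := card_Hmin_le_one F
  calc (Tset 1 F ∪ Tset (-1) F ∪ Hmax F ∪ Hmin F).card
      ≤ (Tset 1 F).card + (Tset (-1) F).card + (Hmax F).card + (Hmin F).card := by
        refine (Finset.card_union_le _ _).trans (Nat.add_le_add_right ?_ _)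
        refine (Finset.card_union_le _ _).trans (Nat.add_le_add_right ?_ _)
        exact Finset.card_union_le _ _
    _ ≤ (Eset 1 F).card + (Eset (-1) F).card + 4 := by omega


/-! ### Stage E: assembly -/

theorem main_bound (w₁ w₂ J : Poly2) (Jf : Poly2 → Poly2)
    (hAT : ∀ (ν : Fin 2 → ℝ) (F : Poly2) (e : Expo), F ≠ 0 → IsAxialLead ν w₁ e → IsEdgeDir ν F →
      IsSpecial ν F e ∨ IsEdgeDir ν (Jf F))
    (hCR : ∀ Q : Poly2, Jf (aeval ![w₁, w₂] Q) = aeval ![w₁, w₂] (pderiv 1 Q) * J)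
    (hO : ∀ (ν : Fin 2 → ℝ) (F G : Poly2), F ≠ 0 → G ≠ 0 →
      (IsEdgeDir ν (F * G) ↔ IsEdgeDir ν F ∨ IsEdgeDir ν G))
    (hS : (S1 w₁).Nonempty) (P : Poly2) (m t : ℕ) (hP : P.totalDegree ≤ m)
    (h1 : w₁.support.card ≤ t) (hJ : J.support.card ≤ t * t) :
    nv (aeval ![w₁, w₂] P) ≤ 2 * ((m + 1) * (3 * (t * t + t) + 2 + (t * t) * (t * t))) + 4 := by
  have hdeg : ∀ s ∈ P.support, s 1 < m + 1 :=
    fun s hs => lt_of_lt_of_le (deg1_lt_of_totalDegree P s hs) (by omega)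
  have hX : ∀ σ : ℝ, (Xc σ w₁).card ≤ t * t + t :=
    fun σ => (card_Xc_le σ w₁).trans (Nat.add_le_add (Nat.mul_le_mul h1 h1) h1)
  have hEJ : ∀ σ : ℝ, (Eset σ J).card ≤ (t * t) * (t * t) :=
    fun σ => (card_Eset_le σ J).trans (Nat.mul_le_mul hJ hJ)
  have T1 := tower (σ := 1) (Or.inl rfl) w₁ w₂ J Jf hAT hCR hO hS (m + 1) P hdeg
  have T2 := tower (σ := -1) (Or.inr rfl) w₁ w₂ J Jf hAT hCR hO hS (m + 1) P hdeg
  have hn := nv_le (aeval ![w₁, w₂] P)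
  have K1 : 3 * (Xc 1 w₁).card + 2 + (Eset 1 J).card ≤ 3 * (t * t + t) + 2 + (t * t) * (t * t) := by
    have := hX 1; have := hEJ 1; omega
  have K2 : 3 * (Xc (-1) w₁).card + 2 + (Eset (-1) J).card ≤ 3 * (t * t + t) + 2 + (t * t) * (t * t) := by
    have := hX (-1); have := hEJ (-1); omega
  have b1 := T1.trans (Nat.mul_le_mul_left (m + 1) K1)
  have b2 := T2.trans (Nat.mul_le_mul_left (m + 1) K2)
  omega

theorem eq_C_of_S1_empty {w : Poly2} (h : ¬ (S1 w).Nonempty) : w = C (coeff 0 w) := by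
  have hsub : ∀ s ∈ w.support, s = 0 := by
    intro s hs; by_contra hne; exact h ⟨s, mem_S1.mpr ⟨hs, hne⟩⟩
  rw [MvPolynomial.ext_iff]
  intro d
  by_cases hd : d = 0
  · subst hd; simp [coeff_C]
  · rw [coeff_C, if_neg (fun h => hd h.symm)]
    by_contra hne
    exact hd (hsub d (MvPolynomial.mem_support_iff.mpr hne))

theorem aeval_C_C (c₁ c₂ : ℂ) (P : Poly2) : ∃ a : ℂ, aeval ![(C c₁ : Poly2), C c₂] P = C a := by
  induction P using MvPolynomial.induction_on with
  | C a => exact ⟨a, by simp⟩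
  | add p q hp hq =>
    obtain ⟨a, ha⟩ := hp; obtain ⟨b, hb⟩ := hq
    exact ⟨a + b, by rw [map_add, ha, hb, C_add]⟩
  | mul_X p i hp =>
    obtain ⟨a, ha⟩ := hp
    refine ⟨a * (![c₁, c₂] i), ?_⟩
    rw [map_mul, ha, aeval_X, C_mul]
    fin_cases i <;> simp

theorem nv_C_le (a : ℂ) : nv (C a : Poly2) ≤ 1 := by
  unfold nv
  have hsub : ((C a : Poly2).support : Set Expo) ⊆ {0} := by
    intro s hs
    have hs' : s ∈ (C a : Poly2).support := hs
    rw [MvPolynomial.mem_support_iff, coeff_C] at hs'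
    by_contra hne
    exact hs' (if_neg (fun h => hne h.symm))
  have h2 : emb '' ((C a : Poly2).support : Set Expo) ⊆ {emb 0} := by
    rintro _ ⟨s, hs, rfl⟩; exact congrArg emb (hsub hs)
  have h3 : Set.extremePoints ℝ (convexHull ℝ (emb '' ((C a : Poly2).support : Set Expo))) ⊆ {emb 0} :=
    extremePoints_convexHull_subset.trans h2
  exact (Set.ncard_le_ncard h3 (Set.finite_singleton _)).trans (by rw [Set.ncard_singleton])

/-- THE TOWER THEOREM, abstract in the toric Jacobian `jac'` through its four kernel properties. -/
theorem rankTwo_bound (jac' : Poly2 → Poly2 → Poly2)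
    (hAT : ∀ (ν : Fin 2 → ℝ) (F w : Poly2) (e : Expo), F ≠ 0 → IsAxialLead ν w e → IsEdgeDir ν F →
      IsSpecial ν F e ∨ IsEdgeDir ν (jac' F w))
    (hCR : ∀ (P w₁ w₂ : Poly2), jac' (aeval ![w₁, w₂] P) w₁ = aeval ![w₁, w₂] (pderiv 1 P) * jac' w₂ w₁)
    (hO : ∀ (ν : Fin 2 → ℝ) (F G : Poly2), F ≠ 0 → G ≠ 0 →
      (IsEdgeDir ν (F * G) ↔ IsEdgeDir ν F ∨ IsEdgeDir ν G))
    (hJS : ∀ (F G : Poly2), (jac' F G).support.card ≤ F.support.card * G.support.card)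
    (m t : ℕ) (P w₁ w₂ : Poly2) (hP : P.totalDegree ≤ m)
    (h1 : w₁.support.card ≤ t) (h2 : w₂.support.card ≤ t) :
    nv (aeval ![w₁, w₂] P) ≤ 2 * ((m + 1) * (3 * (t * t + t) + 2 + (t * t) * (t * t))) + 4 := by
  by_cases hS1 : (S1 w₁).Nonempty
  · exact main_bound w₁ w₂ (jac' w₂ w₁) (fun F => jac' F w₁) (fun ν F e => hAT ν F w₁ e)
      (fun Q => hCR Q w₁ w₂) hO hS1 P m t hP h1 ((hJS w₂ w₁).trans (Nat.mul_le_mul h2 h1))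
  by_cases hS2 : (S1 w₂).Nonempty
  · -- swap the roles of w₁ and w₂
    set P' : Poly2 := rename (Equiv.swap (0 : Fin 2) 1) P with hP'
    have hsw : aeval ![w₁, w₂] P = aeval ![w₂, w₁] P' := by
      rw [hP', aeval_rename]
      have hfun : (![w₂, w₁] ∘ ⇑(Equiv.swap (0 : Fin 2) 1) : Fin 2 → Poly2) = ![w₁, w₂] := by
        funext i
        fin_cases i <;> simp [Equiv.swap_apply_left, Equiv.swap_apply_right]
      rw [hfun]
    have hdeg' : P'.totalDegree ≤ m := (totalDegree_rename_le _ _).trans hP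
    rw [hsw]
    exact main_bound w₂ w₁ (jac' w₁ w₂) (fun F => jac' F w₂) (fun ν F e => hAT ν F w₂ e)
      (fun Q => hCR Q w₂ w₁) hO hS2 P' m t hdeg' h2 ((hJS w₁ w₂).trans (Nat.mul_le_mul h1 h2))
  · -- both constant
    rw [eq_C_of_S1_empty hS1, eq_C_of_S1_empty hS2]
    obtain ⟨a, ha⟩ := aeval_C_C (coeff 0 w₁) (coeff 0 w₂) P
    rw [ha]
    have := nv_C_le a
    omega

theorem k1_arith (m t : ℕ) :
    2 * ((m + 1) * (3 * (t * t + t) + 2 + (t * t) * (t * t))) + 4 ≤ (m + 2) ^ 5 * (t + 2) ^ 5 := by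
  set X := 3 * (t * t + t) + 2 + (t * t) * (t * t) with hX
  have hX5 : 2 * X + 4 ≤ (t + 2) ^ 5 := by
    have e : (t + 2) ^ 5 = t ^ 5 + 10 * t ^ 4 + 40 * t ^ 3 + 80 * t ^ 2 + 80 * t + 32 := by ring
    rw [e, hX]
    ring_nf
    nlinarith [Nat.zero_le (t ^ 5), Nat.zero_le (t ^ 4), Nat.zero_le (t ^ 3), Nat.zero_le (t ^ 2), Nat.zero_le t]
  have hm : 2 * ((m + 1) * X) + 4 ≤ (m + 2) * (2 * X + 4) := by ring_nf; nlinarith [Nat.zero_le (m * X), Nat.zero_le X, Nat.zero_le m]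
  calc 2 * ((m + 1) * X) + 4 ≤ (m + 2) * (2 * X + 4) := hm
    _ ≤ (m + 2) ^ 5 * (t + 2) ^ 5 :=
        Nat.mul_le_mul (Nat.le_self_pow (by norm_num) _) hX5



/-- THE CRUDE RANK-TWO BOUND (kernel): `nv(P(w₁,w₂)) ≤ 2(m+1)(t⁴+3t²+3t+2) + 4` for `totalDegree P ≤ m` and `t`-sparse
`w₁, w₂` — the abstract tower `rankTwo_bound` instantiated by the kernel theorems `axialTransfer`, `chainRule`,
`ostrowski`, `jacSupportBound` of this file. -/
theorem rankTwoCrudeBound (m t : ℕ) (P w₁ w₂ : Poly2) (hP : P.totalDegree ≤ m)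
    (h1 : w₁.support.card ≤ t) (h2 : w₂.support.card ≤ t) :
    nv (MvPolynomial.aeval ![w₁, w₂] P) ≤ 2 * ((m + 1) * (3 * (t * t + t) + 2 + (t * t) * (t * t))) + 4 :=
  rankTwo_bound jac axialTransfer chainRule ostrowski (fun F G => (jacSupportBound F G).1) m t P w₁ w₂ hP h1 h2

/-- **K13 K1 IN THE KERNEL** (VERDICT #26 (U1) toy of record, g8 `RankTwoCompositionLaw` verbatim): the rank-two
composition law holds, with exponent `c = 5` (crude chart counts; the memo's arc count gives `c = 2`).
Nothing here closes 5906 / `PlanarCellBound`; VP ≠ VNP is NOT proved. -/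
theorem rankTwoCompositionLaw : RankTwoCompositionLaw :=
  ⟨5, fun m t P w₁ w₂ hP h1 h2 => (rankTwoCrudeBound m t P w₁ w₂ hP h1 h2).trans (k1_arith m t)⟩

end TowerKernel

end Summit.ValiantsHypothesis.ValiantsHypothesis.Cruxes.TwoProducts.ValIdea35g9
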